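import Literature.MathematicalPhysics.QuantumFieldTheory.Balaban1983to89.B15Prop1AtZSequenceRecord
import Literature.MathematicalPhysics.QuantumFieldTheory.Balaban1983to89.Node00.Record12BgRowTopDomain
import Literature.MathematicalPhysics.QuantumFieldTheory.Balaban1983to89.BlockAveragingSectionQsstar
import Literature.MathematicalPhysics.QuantumFieldTheory.Balaban1983to89.T3DescentFibreTower
import Literature.MathematicalPhysics.QuantumFieldTheory.BalabanImbrieJaffe1984to88.BIJ85Eq224ProofPart2

/-!
# `Balaban1983to89.B15Prop1DatumSmall7AtZSequence` — [Balaban1989LargeFieldI] (1.74) p. 192 and p. 193 ll. 14–20 ∕ [Balaban1985Variational] (7)–(8)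
# pp. 278–279 ∕ [Balaban1988Convergent] (2.13), (2.16) pp. 256–257: ★★ PRINT'S HYPOTHESIS (7) FOR THE (1.74) DATUM `M˙(Q_k^{s*}Ṽ_k)` ALONG `Z`'S MAXIMAL
# SEQUENCE (proved), and ★★★ PROPOSITION 1 [IV] AT PRINT'S (1.74) OBJECT WITH THE NEAR-VALUE LETTER (Vn) DISCHARGED from [15] Theorem 1 (R) at `Z`'s sequence

Honest framing: statement-level skeleton of published theorems with citation tags; proofs where landed; nothing here is a claim about
the Yang–Mills mass gap.

Cell pub-ymgap, HUMAN RULING D-0062 (Track A full width), seat `pub-ymgap-dag-n12-c` (R134 acceleration seat (a), strategy s1 of DAG node N12 = [B15];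
generation g11).  This module takes the lineage's located next step (g10's LOCATED-GENFORM, `B15Prop1AtZSequenceRecord` module docstring) WITHOUT a new
named fact: the near-value letter (Vn) of `B15Prop1AtZSequenceRecord.…_atZSeqCoPRecord_ofNearValue` (p544746 §2) — print's *«It has to be regular on Z, more
exactly we have |∂U_{k,Z} − 1| < O(1)B₃M²εη² by Theorem 1 [15]»* ([IV] p. 193 ll. 17–20) summed over the plaquettes meeting `Ω₁(Z)` — is DERIVED from

* the INSTANCE-LEVEL letter «[15] Theorem 1 (R) at `Z`'s maximal sequence `{Ω_n(Z)} = maxDomT ν.M₁ Z`» (`h15Z` below): verbatim the body of NODE 00's named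
  fact `Node00.VariationalThm1RegSepTop7M F 2 Sup B₃ a₀ a₁` (`Node00/Record12BgRowCoClassCPM`) AFTER its sequence binder — `s.Ω := maxDomT ν.M₁ Z`,
  `Sup ν K s.Ω := Node00.suppDomOfRecord F ν Kt (maxDomT ν.M₁ Z)`, `ε₀ := ν.εreg` — and after its separation ∕ `0 < M₁` ∕ `ε₀ ≤ a₀` premises (the consumer's
  numerics of record).  It is a HYPOTHESIS BINDER, not a `def … : Prop`: the tree's facts `VariationalThm1RegSep{Top7M,CoP7M}` are indexed by
  `s : Node00.SeqOfRecord F ν M g K k` (unions of `LʲMR_j`-cubes) and do not instantiate at `Z`'s sequence (unions of `LʲM₁`-cubes); their general-sequence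
  edition (their own «TODO(general form)») is NODE 00's [15]-leaf and serves `h15Z` by one application when it lands.  Nothing of [15] is typed or asserted here.
* ★★ PRINT'S (7) FOR THE DATUM — [IV] p. 193 ll. 14–16 *«Now let us define V_k′ = Ṽ_k on Z and V_k′ = V_k on Zᶜ.  This configuration satisfies all the above
  conditions»* — PROVED (§1–§4, generic lattice `P`, gauge group `G`, Bałaban's (0.4) block averaging `blockAvg ℰ` with `ℰ(1,…,1) = 1`):
  (i) on CONSISTENT data `M˙(U) = (M^j(U))_j` print's MIXED (7) field ([15] p. 278 L26–33, NODE 00's `Sect2.mixedField`: the bonds off `Λ_{m+1}` carry the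
  AVERAGED finer datum) IS the level-`(m+1)` datum (`mixedField_avgFamily`; `M^{m+1}(U) = M(M^m(U))` by construction);
  (ii) the scale-`j` average of the pulled-back datum is the pull-back of `V` to scale `j`: `M^j(Q^{s*}_{j+n}V) = Q^{s*}_nV` (`iter_blockAvg_qsstarGIter0_add`,
  from r05's section property `BlockAveragingSectionQsstar.iter_blockAvg_qsstarGIter0`, [III] (2.16) p. 257 ∕ [BalabanImbrieJaffe1985] (2.19));
  (iii) a plaquette variable of a pulled-back field is `1` or the plaquette variable of `V` on the block plaquette, and in the second case the block map
  carries all four corners (`plaqHol_qsstarGIter_dichotomy`, `plaqHol_qsstarGIter0_dichotomy`, `blockOfIter_shift_shift`, `blockIter_shift_shift`; p31's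
  `BIJ85Eq453GaugeField.plaqHol_qsstarGIter_of_mem ∕ _of_not_mem`, (4.5.3) [BalabanImbrieJaffe1985]);
  (iv) in a union of `k`-blocks `Y`, the `k`-block of (the centre of) a `j`-point of `Y` is a `k`-point of `Y` (`blockIter_add_embIter`, `blockOfIter_mem_pts`);
  hence ★★ `dataSmall7PTop_avgFamily_qsstarGIter0`: NODE 00's `Sect2.DataSmall7PTop av Ω Ω₀ k δ (M˙(Q_k^{s*}V))` for ANY sequence `Ω` and top domain `Ω₀`
  whose (7) ranges (`Sect2.printedPlaqsTop Ω Ω₀ k`, `Sect2.printedPlaqs Ω k (m+1)`) lie inside a union of `k`-blocks `Y` on whose `k`-plaquettes `V` is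
  `δ`-small — at the record: `Y := Z`, `V := Ṽ_k = ext V_k` (the p. 193 extension, `12d(n+2)²ε`-regular on `Z^{(k)}` by `B15ShellGauge193Local.dist1_plaqHol_extend_shellGauge_le`).
* ★★★ `nearValue_letter_of_thm1AtZSeq`: (Vn) at `bg_Z := Node00.bgMSCoPOfRecord F 2 ν Kt k (maxDomT ν.M₁ Z)` with constant `cA ≥ ½(B₃(c_E+1)η₁²)²·#plaquettes`
  from `h15Z` + the (7) above + `B15Prop1GradientFromNearValueAtCoPRecord.nearValue_le_of_plaqSmallOn` (scale-`1` clause of (8): `Sect2.omegaPlaqsTop … 1 =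
  plaqsOf (Ω₁(Z))`) on the solvable set, and `= 0` off it (`Node00.UminOfRecord_of_not`, `wilsonLoc_one_cfg`); ★★★
  `exists_domain_prop1Printed_lfVarOn_std_su2_box_intrinsic_analytic_atZSeqCoPRecord_ofThm1AtZSeq` = p544746 §2's endpoint VERBATIM with `hVn` replaced by
  `h15Z` + the letters below (proof: that endpoint ∘ `nearValue_letter_of_thm1AtZSeq`); ★★★ `…_ofThm1AtZSeq_geom` (§9): the same with the range letters (Gᵇ)
  DISCHARGED by §8 — the (7) ranges of `Z`'s maximal sequence lie inside `Z` (r11's `dist_maxDomT` on the universal cover: a `T^{(j)}`-step of a centre is the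
  integer step `L^j e_μ` on the cover, `cover_add_single_pow`; the four centres of a scale-`j` plaquette are within `L^j` of each other; the corners of a fine
  plaquette meeting the support are within `2M₁` of `Ω₁(Z)` modulo a deck translation, `B15Eq112TorusCover.cover_eq_cover_iff`).

LETTERS INTRODUCED (all geometric ∕ bookkeeping; none analytic).  (Gᵃ) `hZblk : IsBlockUnion k Z` — print's `Z` is a union of `M`-cubes of `T₁^{(k)}`, hence of
`k`-blocks ([IV] (1.70)–(1.73) p. 191–192).  (Gᵇ) `hR0`, `hRsucc` — the (7) ranges of `Z`'s maximal sequence lie inside `Z`: `printedPlaqsTop (maxDomT ν.M₁ Z)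
(suppDomOfRecord …) k ⊆ plaqsInside Z` and `printedPlaqs (maxDomT ν.M₁ Z) k (m+1) ⊆ plaqsInside (Z^{(m+1)})` — displayed in §5–§6 and DISCHARGED in §8–§9 from
r11's printed distance condition *«dist(Ω_n, Ωᶜ_{n−1}) ≧ LⁿξM₁»* (`B14.Eq213DetSet.dist_maxDomT`) under print's `M₁ ≥ 2` and the torus divisibility
`L^{k}M₁ ∣ 2L^{m+K}` of the cube partitions (the support is `Ω₁(Z)` plus ONE layer of `M₁`-cubes, [III] p. 255, within `2M₁ ≤ LM₁ − 1` of `Ω₁(Z)`; the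
scale-`j` (7) plaquettes touch `Ω_j(Z)^{(j)}`, their centres within `L^j ≤ LʲM₁ − 1` of it).  Bookkeeping: `hcE` (a uniform bound `c_E ≥ 12d(n_i+2)²`, e.g.
`12d·(sitesPerDir 0)²`), `heRa` (`(c_E+1)e_R ≤ a₁`, `B₃(c_E+1)e_R ≤ εreg`: the regularity threshold below [15]'s `a₁` and the class threshold), `hB₃ : 0 ≤ B₃`,
`hcA`.  The old letters of p544746 §2 ((J1) `hGj`, (L2) `hlead`+`hsm`∕`hγle`, `hfar`, `0 < k ≤ m+K`, structure, `hcl`) are unchanged.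

LOCATED (recorded).  The instance-level letter `h15Z` quantifies the data thresholds `δ` with [15]'s numerics side conditions exactly as the K0 fact does; the
proof uses the constant family `δ_n := (c_E+1)ε` (comparability trivial).  The near value is read at scale `1` (`Ω₁(Z)`), inside the support, so the scale-`0`
collar clause of the class is not needed for (Vn) — only for (7)₀, which is why (Gᵇ) asks the level-`0` range inside `Z` (the rim plaquettes of the support
`hull(Ω₁(Z))` stick one fine layer out of it; with `dist(Ω₁(Z), Zᶜ) ≥ LM₁` they stay inside `Z`).

CONTENTS.  §1 `mixedField_avgFamily`.  §2 `qsstarGIter0_add`, `iter_blockAvg_qsstarGIter0_add`, `plaqHol_qsstarGIter_dichotomy`, `plaqHol_qsstarGIter0_dichotomy`.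
§3 `blockOfIter_shift_shift`, `blockIter_shift_shift`, `blockIter_add_embIter`, `blockOfIter_mem_pts`, `blockIter_mem_pts` (+ 3 private coordinate lemmas).
§4 `plaqSmallOn_qsstarGIter_of_isBlockUnion`, `plaqSmallOn_qsstarGIter0_of_isBlockUnion`, ★★ `dataSmall7PTop_avgFamily_qsstarGIter0`.  §5 ★★★
`nearValue_letter_of_thm1AtZSeq`.  §6 ★★★ `exists_domain_prop1Printed_lfVarOn_std_su2_box_intrinsic_analytic_atZSeqCoPRecord_ofThm1AtZSeq`.  §7 non-vacuity of (Gᵃ)(Gᵇ)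
at `Z = T_η` (`isBlockUnion_univ`, `subset_plaqsInside_univ`, `subset_plaqsInside_pts_univ`).  §8 (Gᵇ) DISCHARGED: `embIter_add` (`ι_j(y + a) = ι_j y + L^j a`),
`embIter_shift_apply`, `cover_add_single_pow` (a `T^{(j)}`-step on the cover), `genSet_subset_pts_of_one_le`, ★★ `printedPlaqs_maxDomT_subset_plaqsInside`
(levels `j ≥ 1`), ★★ `printedPlaqsTop_maxDomT_subset_plaqsInside` (level `0`) (+ 2 private `Within` lemmas).  §9 ★★★ `nearValue_letter_of_thm1AtZSeq_geom`,
★★★ `exists_domain_prop1Printed_lfVarOn_std_su2_box_intrinsic_analytic_atZSeqCoPRecord_ofThm1AtZSeq_geom` (§5–§6 with (Gᵇ) replaced by `2 ≤ M₁` and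
`LᵏM₁ ∣ 2L^{m+K}`).  No `def`, no `instance`, no `sorry`; axioms standard.

HONEST SCOPE.  Count-neutral: one printed step of [IV] p. 193 proved ((7) for the (1.74) datum) and the lineage's bespoke (Vn) letter replaced by the printed
theorem it comes from, taken as an instance-level hypothesis; (J1)∕(L2) and [15] Thm 1 itself remain NODE 00's ([15] Thm 1 ∕ Prop. 9; [LF-II] pp. 357–359); NOT a
discharge of N12; nothing continuum ∕ OS ∕ mass-gap ∕ Clay.
-/

noncomputable section

open Set

namespace Literature.MathematicalPhysics.QuantumFieldTheory.Balaban1983to89.B15Prop1DatumSmall7AtZSequence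

open B15DeterminingSets GaugeField B15Prop1Carrier B8Eq17ClassAkV1 BlockAveraging
open B14.Eq22Determines (blockIter IsBlockUnion)
open B7SectAStatements (blockOfIter blockOfIter_zero blockOfIter_succ)
open B15Eq177GaugeInvariance (blockIter_embIter)
open Literature.MathematicalPhysics.QuantumFieldTheory.BalabanImbrieJaffe1984to88.BIJ85Eq453GaugeField
open Literature.MathematicalPhysics.QuantumFieldTheory.BalabanImbrieJaffe1984to88.BIJ85Eq224ProofPart2
  (torusEdgeCellsIter mem_edgeBIter_iff mem_edgeB_iff')
open Literature.MathematicalPhysics.QuantumFieldTheory.BalabanImbrieJaffe1984to88.BIJ85CurlQsstar (torusEdgeCells)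

/-! ## §1 Consistent multi-scale data `M˙(U)`: print's MIXED (7) field collapses -/

section Consistent

variable {P : Params} {G : Type*} [GaugeGroup G]

/-- **PRINT'S MIXED (7) FIELD COLLAPSES ON CONSISTENT DATA**: for the family `M˙(U) = (M^j(U))_j` of ALL averages of one fine configuration ([III] (2.11)), the
(7) field at level `m+1` — the datum `M^{m+1}(U)` on the bonds of `Λ_{m+1}`, the one-step average of the finer datum `M(M^m(U))` off them ([15] p. 278 L26–33
*«we replace V_b by V̄_b»*) — IS `M^{m+1}(U)`, since `M^{m+1}(U) = M(M^m(U))` by construction (`Setup.Averaging.iter`).  Literature-side twin of the Summits-side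
`…BalabanUVNodesK0ConstantDirectionTower.mixedField_avgFamily_succ` (dag-n21-c), which a Literature module cannot import.
[cite: Balaban1985Variational, (7) p.278 L26–33; Balaban1988Convergent, (2.11) p.256] -/
theorem mixedField_avgFamily (av : ∀ j, Averaging P j G) {m : ℕ} (S : Set (Site P (m + 1))) (U : GaugeField P 0 G) :
    Node00.Sect2.mixedField av S (avgFamily av U (m + 1)) (avgFamily av U m) = avgFamily av U (m + 1) := by
  funext b
  by_cases hb : b ∈ bondsOf S
  · exact Node00.Sect2.mixedField_of_mem av _ _ hb
  · exact Node00.Sect2.mixedField_of_not_mem av _ _ hb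

end Consistent

/-! ## §2 The pull-back `Q_k^{s*}V` and its averages -/

section PullBack

variable {P : Params} {G : Type*} [GaugeGroup G]

/-- **`Q^{s*}_{j+n} = Q^{s*}_j ∘ Q^{s*}_n`**: the base-`0` pull-back from scale `j+n` (p31's `qsstarGIter0`) is the base-`0` pull-back from scale `j` of the
base-`j` `n`-fold pull-back (`qsstarGIter (i := j) n`) — both peel the one-step factors from the top (induction on `n`; all casts avoided by the spelling
`j + n`). [cite: BalabanImbrieJaffe1985, (4.5.3) p.312; Balaban1988Convergent, (2.16) p.257] -/
theorem qsstarGIter0_add (j : ℕ) : ∀ (n : ℕ) (V : GaugeField P (j + n) G),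
    qsstarGIter0 (j + n) V = qsstarGIter0 j (qsstarGIter (i := j) n V)
  | 0, _ => rfl
  | n + 1, V => by
    show qsstarGIter0 (j + n) (qsstarG V) = qsstarGIter0 j (qsstarGIter n (qsstarG V))
    exact qsstarGIter0_add j n (qsstarG V)

/-- **`M^j(Q^{s*}_{j+n}V) = Q^{s*}_nV`**: the scale-`j` entry of the (1.74)∕(2.16) datum `M˙(Q^{s*}V)` of a scale-`(j+n)` configuration `V` is the pull-back of
`V` to scale `j`, for Bałaban's (0.4) block averaging `blockAvg ℰ` with any small-loop average `ℰ` fixing constant families (`ℰ(1,…,1) = 1`; the printed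
exp[mean log]: `T3DescentFibreTower.expMeanLogSU_E_one`) — r05's section property `M^j(Q^{s*}_jW) = W` (`BlockAveragingSectionQsstar.iter_blockAvg_qsstarGIter0`)
at `W := Q^{s*}_nV`. [cite: Balaban1988Convergent, (2.16) p.257, p.267 L5–7; BalabanImbrieJaffe1985, (2.19) p.305] -/
theorem iter_blockAvg_qsstarGIter0_add (ℰ : LoopAverage G) (hE : ∀ n : ℕ, ℰ.E (fun _ : Fin (n + 1) => (1 : G)) = 1)
    {j n : ℕ} (hj : j ≤ P.m + P.K) (V : GaugeField P (j + n) G) :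
    Averaging.iter (fun i => blockAvg (P := P) (j := i) ℰ) j (qsstarGIter0 (j + n) V) = qsstarGIter (i := j) n V := by
  rw [qsstarGIter0_add]
  exact BlockAveragingSectionQsstar.iter_blockAvg_qsstarGIter0 ℰ hE j hj _

/-- **PLAQUETTE DICHOTOMY FOR THE `n`-FOLD PULL-BACK AT BASE `j`**: a scale-`j` plaquette variable of `Q^{s*}_nV` is `1`, or `p` is an `n`-fold edge plaquette —
the `n`-fold block map carries the two edges at its base corner to the edges of the block plaquette `p̄ = ⟨B^n(x), μ, ν⟩` — and the variable is `V(∂p̄)`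
(p31's `plaqHol_qsstarGIter_of_mem ∕ _of_not_mem` over the `k`-fold edge cells `BIJ85Eq224ProofPart2.torusEdgeCellsIter`; standing range, `2 ≤ d`).
[cite: BalabanImbrieJaffe1985, (4.5.3) p.312, (2.24) p.305] -/
theorem plaqHol_qsstarGIter_dichotomy (hd : 2 ≤ P.d) {j n : ℕ} (hjn : j + n ≤ P.m + P.K) (V : GaugeField P (j + n) G)
    (p : Plaq P j) :
    plaqHol (qsstarGIter (i := j) n V) p = 1 ∨
      ((blockOfIter n (p.src.shift p.μ) = (blockOfIter n p.src).shift p.μ ∧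
          blockOfIter n (p.src.shift p.ν) = (blockOfIter n p.src).shift p.ν) ∧
        plaqHol (qsstarGIter (i := j) n V) p = plaqHol V ⟨blockOfIter n p.src, p.μ, p.ν, p.hμν⟩) := by
  by_cases h : ∃ p', p ∈ (torusEdgeCellsIter P j n hd).B p'
  · obtain ⟨p', hp'⟩ := h
    obtain ⟨hedge, hbar⟩ := (mem_edgeBIter_iff n hd p' p).1 hp'
    refine Or.inr ⟨hedge, ?_⟩
    rw [plaqHol_qsstarGIter_of_mem hd n hjn V hp', ← hbar]
  · exact Or.inl (plaqHol_qsstarGIter_of_not_mem hd n hjn V fun p' hp' => h ⟨p', hp'⟩)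

/-- **PLAQUETTE DICHOTOMY FOR THE BASE-`0` `k`-FOLD PULL-BACK `Q_k^{s*}V`** (p31's `qsstarGIter0`, the composite of record in (1.74)∕(2.16)), spelled with r12's
cast-free `k`-fold block map `B14.Eq22Determines.blockIter`: a fine plaquette variable of `Q_k^{s*}V` is `1`, or the block map carries the two edges at the base
corner and the variable is `V(∂p̄)`, `p̄ = ⟨B^k(x), μ, ν⟩` (induction on `k` through `Q^{s*}_{k+1} = Q^{s*}_k ∘ Q^{s*}` and the one-step lemmas
`plaqHol_qsstarG_of_mem ∕ _of_not_mem`, `BIJ85Eq224ProofPart2.mem_edgeB_iff'`; standing range, `2 ≤ d`). [cite: BalabanImbrieJaffe1985, (4.5.3) p.312, (2.21) p.305] -/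
theorem plaqHol_qsstarGIter0_dichotomy (hd : 2 ≤ P.d) : ∀ (k : ℕ), k ≤ P.m + P.K → ∀ (V : GaugeField P k G) (p : Plaq P 0),
    plaqHol (qsstarGIter0 k V) p = 1 ∨
      ((blockIter k (p.src.shift p.μ) = (blockIter k p.src).shift p.μ ∧
          blockIter k (p.src.shift p.ν) = (blockIter k p.src).shift p.ν) ∧
        plaqHol (qsstarGIter0 k V) p = plaqHol V ⟨blockIter k p.src, p.μ, p.ν, p.hμν⟩)
  | 0, _, _, _ => Or.inr ⟨⟨rfl, rfl⟩, rfl⟩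
  | k + 1, hk, V, p => by
    rw [qsstarGIter0_succ]
    rcases plaqHol_qsstarGIter0_dichotomy hd k (Nat.le_of_succ_le hk) (qsstarG V) p with h | ⟨⟨hμ, hν⟩, h⟩
    · exact Or.inl h
    · by_cases h1 : ∃ p', (⟨blockIter k p.src, p.μ, p.ν, p.hμν⟩ : Plaq P k) ∈ (torusEdgeCells P k hd).B p'
      · obtain ⟨p', hp'⟩ := h1
        obtain ⟨⟨hμ', hν'⟩, hbar⟩ := (mem_edgeB_iff' hd p' _).1 hp'
        refine Or.inr ⟨⟨?_, ?_⟩, ?_⟩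
        · show blockOf (blockIter k (p.src.shift p.μ)) = (blockOf (blockIter k p.src)).shift p.μ
          rw [hμ]; exact hμ'
        · show blockOf (blockIter k (p.src.shift p.ν)) = (blockOf (blockIter k p.src)).shift p.ν
          rw [hν]; exact hν'
        · rw [h, plaqHol_qsstarG_of_mem hk hd V hp', ← hbar]
          rfl
      · exact Or.inl (by rw [h]; exact plaqHol_qsstarG_of_not_mem hk hd V fun p' hp' => h1 ⟨p', hp'⟩)

end PullBack

/-! ## §3 Block geometry: the fourth corner and the centres -/

section Geometry

variable {P : Params}

/-- `blockOf` acts coordinatewise. [folklore] -/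
private theorem blockOf_apply_congr {j : ℕ} {x y : Site P j} {κ : Fin P.d} (h : x κ = y κ) : blockOf x κ = blockOf y κ := by
  show ((((x κ).val / P.L : ℕ)) : ZMod (P.sitesPerDir (j + 1))) = (((y κ).val / P.L : ℕ) : ZMod (P.sitesPerDir (j + 1)))
  rw [h]

/-- `blockOfIter n` acts coordinatewise. [folklore] -/
private theorem blockOfIter_apply_congr {j : ℕ} {x y : Site P j} {κ : Fin P.d} (h : x κ = y κ) :
    ∀ n : ℕ, blockOfIter n x κ = blockOfIter n y κ
  | 0 => h
  | n + 1 => blockOf_apply_congr (blockOfIter_apply_congr h n)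

/-- `blockIter k` acts coordinatewise. [folklore] -/
private theorem blockIter_apply_congr {x y : Site P 0} {κ : Fin P.d} (h : x κ = y κ) :
    ∀ k : ℕ, blockIter k x κ = blockIter k y κ
  | 0 => h
  | k + 1 => blockOf_apply_congr (blockIter_apply_congr h k)

/-- **THE FOURTH CORNER FOLLOWS THE TWO EDGES** (`n`-fold blocks at base `j`): if the block map carries `x + e_μ` and `x + e_ν` to the neighbours of `B^n(x)`, it
carries `x + e_μ + e_ν` to `B^n(x) + e_μ + e_ν` (the block map acts coordinatewise) — BIJ's *«these L-blocks contain the corners of p′»* for the fourth corner.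
[cite: BalabanImbrieJaffe1985, (2.21) p.305] -/
theorem blockOfIter_shift_shift {j n : ℕ} {x : Site P j} {μ ν : Fin P.d} (hne : μ ≠ ν)
    (hμ : blockOfIter n (x.shift μ) = (blockOfIter n x).shift μ) (hν : blockOfIter n (x.shift ν) = (blockOfIter n x).shift ν) :
    blockOfIter n ((x.shift μ).shift ν) = ((blockOfIter n x).shift μ).shift ν := by
  funext κ
  by_cases hκ : κ = ν
  · subst hκ
    have e1 : ((x.shift μ).shift κ) κ = (x.shift κ) κ := by
      simp only [Site.shift, Function.update_self, Function.update_of_ne (Ne.symm hne)]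
    rw [blockOfIter_apply_congr e1 n, hν]
    simp only [Site.shift, Function.update_self, Function.update_of_ne (Ne.symm hne)]
  · have e2 : ((x.shift μ).shift ν) κ = (x.shift μ) κ := by
      simp only [Site.shift, Function.update_of_ne hκ]
    rw [blockOfIter_apply_congr e2 n, hμ]
    simp only [Site.shift, Function.update_of_ne hκ]

/-- **THE FOURTH CORNER FOLLOWS THE TWO EDGES** (`k`-fold blocks at base `0`, r12's `blockIter`): as `blockOfIter_shift_shift`. [cite: BalabanImbrieJaffe1985, (2.21) p.305] -/
theorem blockIter_shift_shift {k : ℕ} {x : Site P 0} {μ ν : Fin P.d} (hne : μ ≠ ν)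
    (hμ : blockIter k (x.shift μ) = (blockIter k x).shift μ) (hν : blockIter k (x.shift ν) = (blockIter k x).shift ν) :
    blockIter k ((x.shift μ).shift ν) = ((blockIter k x).shift μ).shift ν := by
  funext κ
  by_cases hκ : κ = ν
  · subst hκ
    have e1 : ((x.shift μ).shift κ) κ = (x.shift κ) κ := by
      simp only [Site.shift, Function.update_self, Function.update_of_ne (Ne.symm hne)]
    rw [blockIter_apply_congr e1 k, hν]
    simp only [Site.shift, Function.update_self, Function.update_of_ne (Ne.symm hne)]
  · have e2 : ((x.shift μ).shift ν) κ = (x.shift μ) κ := by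
      simp only [Site.shift, Function.update_of_ne hκ]
    rw [blockIter_apply_congr e2 k, hμ]
    simp only [Site.shift, Function.update_of_ne hκ]

/-- **THE `(j+n)`-BLOCK OF THE CENTRE OF A `j`-BLOCK IS ITS `n`-FOLD BLOCK**: `B^{j+n}(ι_j y) = B^n(y)` for `y ∈ T^{(j)}` viewed in `T_η` through the iterated
centre embedding `embIter j` ([I] p. 251 *«Each lattice determines a lattice of centers of these cubes»*) — induction on `n` from type-B15's
`B15Eq177GaugeInvariance.blockIter_embIter` (`B^j(ι_j y) = y`); standing range `j + n ≤ m + K`. [cite: Balaban1987RG1, (0.1) p.251] -/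
theorem blockIter_add_embIter (j : ℕ) : ∀ (n : ℕ), j + n ≤ P.m + P.K → ∀ c : Site P j,
    blockIter (j + n) (embIter j c) = blockOfIter n c
  | 0, h, c => blockIter_embIter j h c
  | n + 1, h, c => by
    show blockOf (blockIter (j + n) (embIter j c)) = blockOf (blockOfIter n c)
    rw [blockIter_add_embIter j n (Nat.le_of_succ_le h) c]

/-- **IN A UNION OF `(j+n)`-BLOCKS `Y`, THE `n`-FOLD BLOCK OF A `j`-POINT OF `Y` IS A `(j+n)`-POINT OF `Y`** (`Y^{(j)}`, `Y^{(j+n)}` in r12's reading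
`B15DeterminingSets.pts`; `B14.Eq22Determines.IsBlockUnion`): [I] p. 251 *«Such a subset determines a set of lattice points, of a given scale, belonging to it»*
for regions that are unions of big blocks ([III] (2.1)). [cite: Balaban1988Convergent, (2.1)–(2.2) p.255; Balaban1987RG1, (0.1) p.251] -/
theorem blockOfIter_mem_pts {j n : ℕ} (hjn : j + n ≤ P.m + P.K) {Y : Set (Site P 0)} (hY : IsBlockUnion (j + n) Y)
    {c : Site P j} (hc : c ∈ pts j Y) : blockOfIter n c ∈ pts (j + n) Y := by
  rw [mem_pts] at hc ⊢
  have h := (hY (embIter j c)).1 hc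
  rwa [blockIter_add_embIter j n hjn c] at h

/-- In a union of `k`-blocks `Y`, the `k`-block of a point of `Y` is a `k`-point of `Y` (one direction of `IsBlockUnion`, cf. r12's
`B14.Eq22Determines.mem_iff_blockIter_mem_pts`). [cite: Balaban1988Convergent, (2.1)–(2.2) p.255] -/
theorem blockIter_mem_pts {k : ℕ} {Y : Set (Site P 0)} (hY : IsBlockUnion k Y) {x : Site P 0} (hx : x ∈ Y) :
    blockIter k x ∈ pts k Y :=
  (hY x).1 hx

end Geometry

/-! ## §4 The (7)-transfer -/

section Transfer

variable {P : Params} {G : Type*} [GaugeGroup G]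

/-- **SMALLNESS TRANSFER FOR THE `n`-FOLD PULL-BACK AT BASE `j`**: if `V` (scale `j+n`) is `δ`-small on the plaquettes inside `Y^{(j+n)}`, `Y` a union of
`(j+n)`-blocks, then `Q^{s*}_nV` is `δ`-small (`0 < δ`) on every set of scale-`j` plaquettes inside `Y^{(j)}` (dichotomy: `1`, or `V(∂p̄)` with all four corners
of `p̄` in `Y^{(j+n)}`). [cite: Balaban1989LargeFieldI, p.193 L14–16; BalabanImbrieJaffe1985, (4.5.3) p.312] -/
theorem plaqSmallOn_qsstarGIter_of_isBlockUnion (hd : 2 ≤ P.d) {j n : ℕ} (hjn : j + n ≤ P.m + P.K) {Y : Set (Site P 0)}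
    (hY : IsBlockUnion (j + n) Y) {S : Set (Plaq P j)} (hS : S ⊆ plaqsInside (pts j Y)) {δ : ℝ} (hδ : 0 < δ)
    {V : GaugeField P (j + n) G} (hV : PlaqSmallOn (plaqsInside (pts (j + n) Y)) δ V) :
    PlaqSmallOn S δ (qsstarGIter (i := j) n V) := by
  intro p hp
  rcases plaqHol_qsstarGIter_dichotomy hd hjn V p with h | ⟨⟨hμ, hν⟩, h⟩
  · rw [h, GaugeGroup.dist1_one]; exact hδ
  · rw [h]
    obtain ⟨h1, h2, h3, h4⟩ := hS hp
    refine hV _ ⟨blockOfIter_mem_pts hjn hY h1, ?_, ?_, ?_⟩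
    · show (blockOfIter n p.src).shift p.μ ∈ pts (j + n) Y
      rw [← hμ]; exact blockOfIter_mem_pts hjn hY h2
    · show (blockOfIter n p.src).shift p.ν ∈ pts (j + n) Y
      rw [← hν]; exact blockOfIter_mem_pts hjn hY h3
    · show ((blockOfIter n p.src).shift p.μ).shift p.ν ∈ pts (j + n) Y
      rw [← blockOfIter_shift_shift (ne_of_lt p.hμν) hμ hν]; exact blockOfIter_mem_pts hjn hY h4

/-- **SMALLNESS TRANSFER FOR THE BASE-`0` PULL-BACK `Q_k^{s*}V`**: if `V` is `δ`-small on the plaquettes inside `Y^{(k)}`, `Y` a union of `k`-blocks, then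
`Q_k^{s*}V` is `δ`-small (`0 < δ`) on every set of fine plaquettes inside `Y`. [cite: Balaban1989LargeFieldI, p.193 L14–16; BalabanImbrieJaffe1985, (4.5.3) p.312] -/
theorem plaqSmallOn_qsstarGIter0_of_isBlockUnion (hd : 2 ≤ P.d) {k : ℕ} (hk : k ≤ P.m + P.K) {Y : Set (Site P 0)}
    (hY : IsBlockUnion k Y) {S : Set (Plaq P 0)} (hS : S ⊆ plaqsInside Y) {δ : ℝ} (hδ : 0 < δ)
    {V : GaugeField P k G} (hV : PlaqSmallOn (plaqsInside (pts k Y)) δ V) :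
    PlaqSmallOn S δ (qsstarGIter0 k V) := by
  intro p hp
  rcases plaqHol_qsstarGIter0_dichotomy hd k hk V p with h | ⟨⟨hμ, hν⟩, h⟩
  · rw [h, GaugeGroup.dist1_one]; exact hδ
  · rw [h]
    obtain ⟨h1, h2, h3, h4⟩ := hS hp
    refine hV _ ⟨blockIter_mem_pts hY h1, ?_, ?_, ?_⟩
    · show (blockIter k p.src).shift p.μ ∈ pts k Y
      rw [← hμ]; exact blockIter_mem_pts hY h2
    · show (blockIter k p.src).shift p.ν ∈ pts k Y
      rw [← hν]; exact blockIter_mem_pts hY h3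
    · show ((blockIter k p.src).shift p.μ).shift p.ν ∈ pts k Y
      rw [← blockIter_shift_shift (ne_of_lt p.hμν) hμ hν]; exact blockIter_mem_pts hY h4

/-- ★★ **PRINT'S HYPOTHESIS (7) OF [15] THEOREM 1 FOR THE (1.74)∕(2.16) DATUM `M˙(Q_k^{s*}V)`, ALONG ANY SEQUENCE** — [IV] p. 193 ll. 14–16 *«V_k′ = Ṽ_k on Z …
This configuration satisfies all the above conditions»*: for Bałaban's (0.4) averaging `av = blockAvg ℰ` (`ℰ(1,…,1) = 1`), any sequence `Ω`, top domain `Ω₀`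
and union of `k`-blocks `Y` containing the (7) ranges (level `0`: `Sect2.printedPlaqsTop Ω Ω₀ k ⊆ plaqsInside Y`; level `m+1 ≤ k`: `Sect2.printedPlaqs Ω k (m+1)
⊆ plaqsInside Y^{(m+1)}`), smallness of `V` on the plaquettes inside `Y^{(k)}` with the thresholds `0 < δ_j` gives NODE 00's `Sect2.DataSmall7PTop av Ω Ω₀ k δ
(M˙(Q_k^{s*}V))` — level `0` by `plaqSmallOn_qsstarGIter0_of_isBlockUnion`; level `m+1`: the MIXED field is `M^{m+1}(Q_k^{s*}V)` (`mixedField_avgFamily`) `=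
Q^{s*}_nV` (`k = m+1+n`, `iter_blockAvg_qsstarGIter0_add`) and `plaqSmallOn_qsstarGIter_of_isBlockUnion`.
[cite: Balaban1989LargeFieldI, (1.74) p.192, p.193 L14–20; Balaban1985Variational, (7) p.278 L20–33; Balaban1988Convergent, (2.11) p.256, (2.16) p.257] -/
theorem dataSmall7PTop_avgFamily_qsstarGIter0 (hd : 2 ≤ P.d) (ℰ : LoopAverage G)
    (hE : ∀ n : ℕ, ℰ.E (fun _ : Fin (n + 1) => (1 : G)) = 1) {av : ∀ j, Averaging P j G} (hav : av = fun _ => blockAvg ℰ)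
    {k : ℕ} (hk : k ≤ P.m + P.K) (Ω : ℕ → Set (Site P 0)) (Ω₀ Y : Set (Site P 0)) (hY : IsBlockUnion k Y)
    (h0 : Node00.Sect2.printedPlaqsTop Ω Ω₀ k ⊆ plaqsInside Y)
    (hsucc : ∀ m, m + 1 ≤ k → Node00.Sect2.printedPlaqs Ω k (m + 1) ⊆ plaqsInside (pts (m + 1) Y))
    {δ : ℕ → ℝ} (hδ : ∀ j, j ≤ k → 0 < δ j) (V : GaugeField P k G)
    (hV : ∀ j, j ≤ k → PlaqSmallOn (plaqsInside (pts k Y)) (δ j) V) :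
    Node00.Sect2.DataSmall7PTop av Ω Ω₀ k δ (avgFamily av (qsstarGIter0 k V)) := by
  subst hav
  refine ⟨plaqSmallOn_qsstarGIter0_of_isBlockUnion hd hk hY h0 (hδ 0 (Nat.zero_le _)) (hV 0 (Nat.zero_le _)), fun m hm => ?_⟩
  rw [mixedField_avgFamily]
  obtain ⟨n, rfl⟩ := Nat.exists_eq_add_of_le hm
  show PlaqSmallOn _ _ (Averaging.iter (fun i => blockAvg ℰ) (m + 1) (qsstarGIter0 (m + 1 + n) V))
  rw [iter_blockAvg_qsstarGIter0_add ℰ hE (by omega) V]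
  exact plaqSmallOn_qsstarGIter_of_isBlockUnion hd hk hY (hsucc m hm) (hδ (m + 1) hm) (hV (m + 1) hm)

end Transfer

/-! ## §5 At `Z`'s maximal sequence: the near-value letter (Vn) from [15] Thm 1 (R) at `Z`'s sequence -/

section AtZSequence

open Classical
open B14.Eq213DetSet B15Sect1Instances B16Sect1Wilson B15Prop1GradientFromNearValue B15Prop1GradientFromNearValueAtCoPRecord
open B15Prop1AtZSequenceRecord
open T4CubeChartGnomonic (SU2)
open B15Extension193 (extend)
open B15ShellGauge193 (shellGauge)
open B15ShellGauge193Local (dist1_plaqHol_extend_shellGauge_le)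
open T4AxialGaugeSmallField (castSite boxPlaqs)
open T4Continuum

/-- ★★★ **THE NEAR-VALUE LETTER (Vn) AT PRINT'S (1.74) OBJECT, DISCHARGED FROM [15] THEOREM 1 (R) AT `Z`'S MAXIMAL SEQUENCE** — [IV] p. 193 ll. 17–20 *«It has to
be regular on Z, more exactly we have |∂U_{k,Z} − 1| < O(1)B₃M²εη² by Theorem 1 [15]»*: for `ε`-regular data `V_k` (`ε ≤ e_R`) the near-field action
`Σ_{p ∈ plaqsOf Ω₁(Z)} (1 − Re tr U_{k,Z}(Ṽ_k)(∂p))` of the (1.74) configuration `U_{k,Z}(Ṽ_k) = U(𝔹_k(Z), M˙(Q_k^{s*}Ṽ_k))` at NODE 00's background of record for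
`Z`'s own sequence, `bg_Z := Node00.bgMSCoPOfRecord F 2 ν Kt k (maxDomT ν.M₁ Z)` (g10's §2 object), is `≤ cA·ε²`.  PROOF: the p. 193 extension `Ṽ_k = ext V_k` is
`12d(n+2)²ε ≤ c_E ε`-regular on `Z^{(k)}` (`B15ShellGauge193Local.dist1_plaqHol_extend_shellGauge_le`), so the datum satisfies (7) along `Z`'s sequence with the
constant thresholds `(c_E+1)ε` (`dataSmall7PTop_avgFamily_qsstarGIter0` with (Gᵃ) `hZblk`, (Gᵇ) `hR0`∕`hRsucc`); on the solvable set `U_{k,Z}(Ṽ_k)` is a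
minimiser over the class of `Z`'s sequence (`Node00.isMinimizer_UminOfRecord`; `Bj ν.M₁ Z k = genSet (maxDomT ν.M₁ Z) k` and the class literal of
`VariationalThm1RegSepTop7M` at `Sup := suppDomOfRecord` IS `regMSCoPOfRecord`, definitionally), so the letter `h15Z` — [15] Thm 1 (R) at that sequence, thresholds
in [15]'s numerics range by `heRa` — gives (8) at scale `1`: `|U(∂p) − 1| < B₃(c_E+1)ε·η₁²` on `plaqsOf Ω₁(Z)` (`Sect2.omegaPlaqsTop … 1`), and
`B15Prop1GradientFromNearValueAtCoPRecord.nearValue_le_of_plaqSmallOn` sums it (`#plaquettes ≤ Fintype.card`); off the solvable set the configuration is the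
unit one and the near value is `0` (`Node00.UminOfRecord_of_not`, `wilsonLoc_one_cfg`).  The letter `h15Z` is the body of `Node00.VariationalThm1RegSepTop7M F 2 Sup
B₃ a₀ a₁` after its sequence binder (`s.Ω := maxDomT ν.M₁ Z`, `Sup ν K s.Ω := suppDomOfRecord F ν Kt (maxDomT ν.M₁ Z)`, `ε₀ := ν.εreg`) and after its
separation ∕ `0 < M₁` ∕ `ε₀ ≤ a₀` premises — served by one application of a general-sequence edition of that fact (NODE 00's [15]-leaf; not typed here).
[cite: Balaban1989LargeFieldI, (1.74) p.192, p.193 L14–20; Balaban1985Variational, (2),(6),(7) p.278, Thm 1 (8) p.279; Balaban1988Convergent, p.255, (2.12)–(2.13)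
pp.256–257, (2.16) p.257] -/
theorem nearValue_letter_of_thm1AtZSeq {F : T4Family} (ν : Node00.Stage7Numerics) (Kt : ℕ) (hd3 : 3 ≤ (F.P Kt).d) {ι : Type}
    (Z Λ : ι → Set (Site (F.P Kt) 0)) (k : ι → ℕ) (hk0 : ∀ i, 0 < k i) (hk : ∀ i, k i ≤ (F.P Kt).m + (F.P Kt).K)
    (eR : ι → ℝ)
    (lo hi : ι → Fin (F.P Kt).d → ℤ) (n : ι → ℕ) (hn : ∀ i κ, hi i κ ≤ lo i κ + n i)
    (hbox : ∀ i, pts (k i) (Λ i) = (castSite '' Set.Icc (lo i) (hi i) : Set (Site (F.P Kt) (k i))))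
    (hZ : ∀ i, (boxPlaqs (lo i - 1) (hi i + 1) : Set (Plaq (F.P Kt) (k i))) ⊆ plaqsInside (pts (k i) (Z i)))
    (hN5 : ∀ i κ, ((hi i κ - lo i κ + 1).toNat : ℤ) + 5 < (F.P Kt).sitesPerDir (k i))
    (ext : ∀ i, GaugeField (F.P Kt) (k i) SU2 → GaugeField (F.P Kt) (k i) SU2)
    (hext : ∀ i Vk, ext i Vk = extend (pts (k i) (Λ i)) (shellGauge Vk (lo i) (hi i)) Vk)
    (hlohi : ∀ i, lo i ≤ hi i)
    -- geometry of `Z` and of its maximal sequence (2.13): `Z` a union of `k`-blocks; the (7) ranges of `{Ω_n(Z)}` lie inside `Z`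
    (hZblk : ∀ i, IsBlockUnion (k i) (Z i))
    (hR0 : ∀ i, Node00.Sect2.printedPlaqsTop (maxDomT ν.M₁ (Z i)) (Node00.suppDomOfRecord F ν Kt (maxDomT ν.M₁ (Z i))) (k i) ⊆
      plaqsInside (Z i))
    (hRsucc : ∀ i m, m + 1 ≤ k i → Node00.Sect2.printedPlaqs (maxDomT ν.M₁ (Z i)) (k i) (m + 1) ⊆ plaqsInside (pts (m + 1) (Z i)))
    -- bookkeeping constants
    {cE B₃ a₁ cA : ℝ} (hcE0 : 0 ≤ cE) (hcE : ∀ i, 12 * ((F.P Kt).d : ℝ) * ((n i : ℝ) + 2) ^ 2 ≤ cE) (hB₃ : 0 ≤ B₃)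
    (heRa : ∀ i, (cE + 1) * eR i ≤ a₁ ∧ B₃ * ((cE + 1) * eR i) ≤ ν.εreg)
    (hcA : 1 / 2 * (B₃ * (cE + 1) * (F.P Kt).eta 1 ^ 2) ^ 2 * (Fintype.card (Plaq (F.P Kt) 0) : ℝ) ≤ cA)
    -- [15] THEOREM 1 (R) AT `Z`'S SEQUENCE `{Ω_n(Z)} = maxDomT ν.M₁ Z` (instance-level letter; the body of `Node00.VariationalThm1RegSepTop7M` at
    -- `s.Ω := maxDomT ν.M₁ (Z i)`, `Sup := suppDomOfRecord`, `ε₀ := ν.εreg`, separation ∕ `0 < M₁` ∕ `εreg ≤ a₀` discharged by the consumer)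
    (h15Z : ∀ i (δ : ℕ → ℝ), (∀ j, j ≤ k i → 0 < δ j ∧ δ j ≤ a₁ ∧ B₃ * δ j ≤ ν.εreg) → (∀ j, j < k i → δ j ≤ 2 * δ (j + 1)) →
      (∀ j, j < k i → δ (j + 1) ≤ 2 * δ j) →
      ∀ W : MSField (F.P Kt) SU2,
        Node00.Sect2.DataSmall7PTop (Node00.avOfRecord F 2 Kt) (maxDomT ν.M₁ (Z i)) (Node00.suppDomOfRecord F ν Kt (maxDomT ν.M₁ (Z i))) (k i) δ W →
        ∀ U₀ : GaugeField (F.P Kt) 0 SU2, IsMinimizer (Node00.avOfRecord F 2 Kt)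
            {U | (∀ j, j ≤ k i → PlaqSmallOn (Node00.Sect2.omegaPlaqsTop (maxDomT ν.M₁ (Z i)) (Node00.suppDomOfRecord F ν Kt (maxDomT ν.M₁ (Z i))) j)
                ((ν.εreg : ℝ) * (F.P Kt).eta j ^ 2) U) ∧
              Node00.Sect2.CoDivClassOnTop (maxDomT ν.M₁ (Z i)) (Node00.suppDomOfRecord F ν Kt (maxDomT ν.M₁ (Z i))) (k i) ν.εreg U}
            (genSet (maxDomT ν.M₁ (Z i)) (k i)) W U₀ →
          (∀ j, j ≤ k i → PlaqSmallOn (Node00.Sect2.omegaPlaqsTop (maxDomT ν.M₁ (Z i)) (Node00.suppDomOfRecord F ν Kt (maxDomT ν.M₁ (Z i))) j)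
              (B₃ * δ j * (F.P Kt).eta j ^ 2) U₀) ∧
            ∀ j, j ≤ k i → Node00.Sect2.CoDivSmallOn (Node00.Sect2.omegaBondsTop (maxDomT ν.M₁ (Z i)) (Node00.suppDomOfRecord F ν Kt (maxDomT ν.M₁ (Z i))) j)
              (B₃ * δ j * (F.P Kt).eta j ^ 3) U₀)
    : ∀ i ε Vk, 0 < ε → ε ≤ eR i → PlaqSmallOn (plaqsInside (pts (k i) (Z i ∩ (Λ i)ᶜ))) ε Vk →
      wilsonLoc ((plaqsOf (maxDomT ν.M₁ (Z i) 1)).indicator fun _ => (1 : ℝ))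
        (bgKZstd (Node00.bgMSCoPOfRecord F 2 ν Kt (k i) (maxDomT ν.M₁ (Z i))) ν.M₁ (Z i) (k i) (ext i Vk)) ≤ cA * ε ^ 2 := by
  intro i ε Vk hε hεR hreg
  have hd : 2 ≤ (F.P Kt).d := by omega
  -- (a) the p. 193 extension is `(cE+1)ε`-small on the `k`-plaquettes inside `Z`
  have hN3 : ∀ κ, hi i κ - lo i κ + 3 < ((F.P Kt).sitesPerDir (k i) : ℤ) := fun κ => by
    have h5 := hN5 i κ
    have hle : lo i κ ≤ hi i κ := hlohi i κ
    rw [Int.toNat_of_nonneg (by linarith)] at h5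
    linarith
  have hδ₀ : 0 < (cE + 1) * ε := by positivity
  have hV : PlaqSmallOn (plaqsInside (pts (k i) (Z i))) ((cE + 1) * ε) (ext i Vk) := by
    intro p hp
    rw [hext]
    have h := (dist1_plaqHol_extend_shellGauge_le hd3 (hlohi i) (hn i) hN3 (hbox i) (hZ i) hε hreg).1 p hp
    calc dist1 (plaqHol (extend (pts (k i) (Λ i)) (shellGauge Vk (lo i) (hi i)) Vk) p)
        ≤ 12 * (F.P Kt).d * (n i + 2) ^ 2 * ε := h
      _ ≤ cE * ε := mul_le_mul_of_nonneg_right (hcE i) hε.le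
      _ < (cE + 1) * ε := by nlinarith
  -- (b) print's (7) for the datum `M˙(Q_k^{s*}Ṽ_k)` along `Z`'s sequence, constant thresholds `(cE+1)ε`
  have h7 : Node00.Sect2.DataSmall7PTop (Node00.avOfRecord F 2 Kt) (maxDomT ν.M₁ (Z i))
      (Node00.suppDomOfRecord F ν Kt (maxDomT ν.M₁ (Z i))) (k i) (fun _ => (cE + 1) * ε)
      (avgFamily (Node00.avOfRecord F 2 Kt) (qsstarGIter0 (k i) (ext i Vk))) :=
    dataSmall7PTop_avgFamily_qsstarGIter0 hd ExpMeanLog.expMeanLogSU T3DescentFibreTower.expMeanLogSU_E_one rfl (hk i)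
      (maxDomT ν.M₁ (Z i)) _ (Z i) (hZblk i) (hR0 i) (hRsucc i) (fun _ _ => hδ₀) (ext i Vk) (fun _ _ => hV)
  -- numerics of the thresholds
  have hnum : ∀ j, j ≤ k i → 0 < (cE + 1) * ε ∧ (cE + 1) * ε ≤ a₁ ∧ B₃ * ((cE + 1) * ε) ≤ ν.εreg := fun j _ => by
    obtain ⟨ha, hb⟩ := heRa i
    have h1 : (cE + 1) * ε ≤ (cE + 1) * eR i := mul_le_mul_of_nonneg_left hεR (by linarith)
    exact ⟨hδ₀, h1.trans ha, (mul_le_mul_of_nonneg_left h1 hB₃).trans hb⟩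
  -- (c) the (1.74) configuration: a minimiser over the class of `Z`'s sequence, or the pinned unit configuration
  rw [bgKZstd_apply, Node00.bgMSCoPOfRecord_U]
  by_cases hsol : ∃ U₀, IsMinimizer (Node00.avOfRecord F 2 Kt) (Node00.regMSCoPOfRecord F 2 ν Kt (k i) (maxDomT ν.M₁ (Z i)))
      (Bj ν.M₁ (Z i) (k i)) (avgFamily (Node00.avOfRecord F 2 Kt) (qsstarGIter0 (k i) (ext i Vk))) U₀
  · have hmin := Node00.isMinimizer_UminOfRecord _ _ hsol
    have h8 := h15Z i (fun _ => (cE + 1) * ε) hnum (fun _ _ => by linarith) (fun _ _ => by linarith) _ h7 _ hmin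
    have h81 : PlaqSmallOn (plaqsOf (maxDomT ν.M₁ (Z i) 1)) (B₃ * ((cE + 1) * ε) * (F.P Kt).eta 1 ^ 2)
        (Node00.UminOfRecord (Node00.avOfRecord F 2 Kt) (Node00.regMSCoPOfRecord F 2 ν Kt (k i) (maxDomT ν.M₁ (Z i)))
          (Bj ν.M₁ (Z i) (k i)) (avgFamily (Node00.avOfRecord F 2 Kt) (qsstarGIter0 (k i) (ext i Vk)))) := by
      have h := h8.1 1 (hk0 i)
      rwa [Node00.Sect2.omegaPlaqsTop_of_ne_zero _ _ one_ne_zero, Node00.omegaPlaqs_of_ne_zero _ one_ne_zero] at h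
    have hδ1 : 0 ≤ B₃ * ((cE + 1) * ε) * (F.P Kt).eta 1 ^ 2 := by positivity
    refine (nearValue_le_of_plaqSmallOn (maxDomT ν.M₁ (Z i) 1) hδ1 _ h81).trans ?_
    calc _ ≤ 1 / 2 * (B₃ * ((cE + 1) * ε) * (F.P Kt).eta 1 ^ 2) ^ 2 * (Fintype.card (Plaq (F.P Kt) 0) : ℝ) := by
          gcongr
          exact_mod_cast (Finset.card_filter_le _ _).trans (le_of_eq Finset.card_univ)
      _ = 1 / 2 * (B₃ * (cE + 1) * (F.P Kt).eta 1 ^ 2) ^ 2 * (Fintype.card (Plaq (F.P Kt) 0) : ℝ) * ε ^ 2 := by ring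
      _ ≤ cA * ε ^ 2 := mul_le_mul_of_nonneg_right hcA (sq_nonneg ε)
  · rw [Node00.UminOfRecord_of_not _ _ hsol, wilsonLoc_one_cfg]
    have h0 : (0 : ℝ) ≤ 1 / 2 * (B₃ * (cE + 1) * (F.P Kt).eta 1 ^ 2) ^ 2 * (Fintype.card (Plaq (F.P Kt) 0) : ℝ) := by positivity
    nlinarith [sq_nonneg ε]

end AtZSequence


/-! ## §6 Proposition 1 at print's (1.74) object with (Vn) DISCHARGED -/

section Endpoint

open Classical
open Metric
open scoped BigOperators RealInnerProductSpace InnerProductSpace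
open B14.Eq213DetSet B15Sect1Instances B16Sect1Wilson B16Sect1Backgrounds B15Prop1GradientFromNearValue B15Prop1GradientFromNearValueAtCoPRecord
open B15Prop1AtZSequenceRecord B15Prop1SliceTaylorCalculus B15Prop1IntrinsicOfFun
open B15Prop1AnalyticExtClause (cplxVec cplxSlice anExt)
open B15Prop1ChartCalculusSU2 (E3)
open T4CubeChartGnomonic (SU2)
open B15Prop1ChartSU2 (su2Chart)
open B15Prop1SliceCoordinates (GaugeSlice ιA freeBonds)
open T4AxialGaugeSmallField (castSite boxPlaqs)
open B6BondElimination (unitVec)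
open B16Eq18Proof (box)
open B15Extension193 (extend)
open B15ShellGauge193 (shellGauge)
open B5Bounds167Lattice (formDk ofRealCfg)
open T4Continuum

/-- ★★★ **PROPOSITION 1 [IV] WITH ITS ANALYTIC-EXTENSION CLAUSE AT PRINT'S (1.74) OBJECT `U_{k,Z} = U(𝔹_k(Z), ·)`, THE NEAR-VALUE LETTER (Vn) DISCHARGED FROM
[15] THEOREM 1 (R) AT `Z`'S SEQUENCE** — `B15Prop1AtZSequenceRecord.exists_domain_prop1Printed_lfVarOn_std_su2_box_intrinsic_analytic_atZSeqCoPRecord_ofNearValue`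
(p544746 §2) VERBATIM — same background `Node00.bgMSCoPOfRecord F 2 ν Kt (k i) (maxDomT ν.M₁ (Z i))`, same carrier, same conclusion — with its letter `hVn`
REPLACED by: (Gᵃ) `hZblk` (`Z` a union of `k`-blocks — print's `Z` is a union of `M`-cubes of `T₁^{(k)}`), (Gᵇ) `hR0`∕`hRsucc` (the (7) ranges of `Z`'s maximal
sequence lie inside `Z`; r11 geometry of (2.13), displayed), the bookkeeping `hcE`∕`heRa`∕`hB₃`∕`hcA`, and the INSTANCE-LEVEL letter `h15Z` = [15] Theorem 1 (R)
at `Z`'s sequence (`nearValue_letter_of_thm1AtZSeq`).  WHAT A CONSUMER SUPPLIES per instance: (J1) `hGj`, (L2) `hlead` + `hsm`∕`hγle`, `h15Z`, `hfar`, (Gᵃ)(Gᵇ),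
`0 < k i ≤ m + K`, structure, numerics, `hcl := Subsingleton.elim _ _`.  Proof: p544746 §2 ∘ `nearValue_letter_of_thm1AtZSeq`.
[cite: Balaban1989LargeFieldI, (1.74) p.192, Prop. 1 (1.77)–(1.78) p.194 (incl. the last clause), p.193 L14–20; Balaban1988Convergent, p.255, (2.12)–(2.13)
pp.256–257, (2.16) p.257; Balaban1985Variational, (2),(5),(6),(7) p.278, Thm 1 (8) p.279, Prop. 9 p.309; Balaban1989LargeFieldII, (1.7)–(1.9) p.358, (1.11)
p.358, (1.12)–(1.13) p.359] -/
theorem exists_domain_prop1Printed_lfVarOn_std_su2_box_intrinsic_analytic_atZSeqCoPRecord_ofThm1AtZSeq {F : T4Family}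
    (ν : Node00.Stage7Numerics) (Kt : ℕ) (hd3 : 3 ≤ (F.P Kt).d) (h0 : 0 < (F.P Kt).d) {ι : Type}
    [hdec : ∀ j, DecidableEq (PBond (F.P Kt) j)] (hcl : hdec = fun _ a b => Classical.propDecidable (a = b))
    (Z Λ : ι → Set (Site (F.P Kt) 0)) (k : ι → ℕ) (M : ι → ℝ) (hk0 : ∀ i, 0 < k i) (hk : ∀ i, k i ≤ (F.P Kt).m + (F.P Kt).K)
    (eR : ι → ℝ) (heR : ∀ i, 0 < eR i)
    (T : ∀ i, Finset (PBond (F.P Kt) (k i)))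
    (lo hi : ι → Fin (F.P Kt).d → ℤ) (n : ι → ℕ) (hn : ∀ i κ, hi i κ ≤ lo i κ + n i) (hN : ∀ i, n i + 2 < (F.P Kt).sitesPerDir (k i))
    (hbox : ∀ i, pts (k i) (Λ i) = (castSite '' Set.Icc (lo i) (hi i) : Set (Site (F.P Kt) (k i))))
    (hZ : ∀ i, (boxPlaqs (lo i - 1) (hi i + 1) : Set (Plaq (F.P Kt) (k i))) ⊆ plaqsInside (pts (k i) (Z i)))
    (hTG0 : ∀ i, T i = (box (fun κ => (hi i κ - lo i κ + 1).toNat) (lo i)).image fun x =>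
      (⟨castSite (x - unitVec ⟨0, h0⟩), ⟨0, h0⟩⟩ : PBond (F.P Kt) (k i)))
    (hN5 : ∀ i κ, ((hi i κ - lo i κ + 1).toNat : ℤ) + 5 < (F.P Kt).sitesPerDir (k i))
    (K : ι → ℕ) (hK1 : ∀ i, 1 ≤ K i) (hKn : ∀ i κ, (hi i κ - lo i κ + 1).toNat ≤ K i)
    (ext : ∀ i, GaugeField (F.P Kt) (k i) SU2 → GaugeField (F.P Kt) (k i) SU2)
    (hext : ∀ i Vk, ext i Vk = extend (pts (k i) (Λ i)) (shellGauge Vk (lo i) (hi i)) Vk)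
    (hlohi : ∀ i, lo i ≤ hi i)
    {γ cJ bx : ℝ} (hγ : 0 < γ) (hcJ : 0 ≤ cJ) (hbx : 0 ≤ bx)
    (hbxM : ∀ i, 12 * ((F.P Kt).d : ℝ) * ((n i : ℝ) + 2) ^ 2 ≤ bx * (M i) ^ 2)
    {Cerr R 𝓐 : ι → ℝ} (hM : ∀ i, 1 ≤ (M i)) (hR : ∀ i, 0 < R i) (h𝓐 : ∀ i, 0 ≤ 𝓐 i)
    (n' : ι → ℕ) (hn' : ∀ i, 1 ≤ n' i)
    -- (J1) the JOINT holomorphic extension of print's function in the datum perturbation and the field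
    (hGj : ∀ i Vk, PlaqSmallOn (plaqsInside (pts (k i) (Z i ∩ (Λ i)ᶜ))) (eR i) Vk →
      ∃ 𝒢 : VecField (F.P Kt) (k i) (EuclideanSpace ℂ (Fin 3)) × VecField (F.P Kt) (k i) (EuclideanSpace ℂ (Fin 3)) → ℂ,
        DifferentiableOn ℂ 𝒢 (ball 0 (R i)) ∧
        (∀ z ∈ ball (0 : VecField (F.P Kt) (k i) (EuclideanSpace ℂ (Fin 3)) × VecField (F.P Kt) (k i) (EuclideanSpace ℂ (Fin 3))) (R i), ‖𝒢 z‖ ≤ 𝓐 i) ∧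
        ∀ p B' : VecField (F.P Kt) (k i) E3, ‖p‖ < R i → ‖B'‖ < R i →
          𝒢 (cplxVec p, cplxVec B') =
            ((fun177std (Node00.bgMSCoPOfRecord F 2 ν Kt (k i) (maxDomT ν.M₁ (Z i))) ν.M₁ (Z i) (k i)
              (expMul su2Chart B' (ext i (expMul su2Chart p Vk))) : ℝ) : ℂ))
    -- (L2) (1.7)–(1.9) p.358 for the Hessian of the slice function at `0`
    (hlead : ∀ i Vk, PlaqSmallOn (plaqsInside (pts (k i) (Z i ∩ (Λ i)ᶜ))) (eR i) Vk →
      ∀ X : GaugeSlice (pts (k i) (Λ i)) (T i) E3,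
      |⟪X, (fderiv ℝ (rGrad (pts (k i) (Λ i)) (T i)
              (sliceFn (pts (k i) (Λ i)) (T i)
                (fun177std (Node00.bgMSCoPOfRecord F 2 ν Kt (k i) (maxDomT ν.M₁ (Z i))) ν.M₁ (Z i) (k i)) (ext i Vk))) 0) X⟫ -
          ∑ a : Fin 3, formDk (n' i) (fun _ : Fin (F.P Kt).d => (F.P Kt).sitesPerDir (k i))
            (ofRealCfg (fun _ : Fin (F.P Kt).d => (F.P Kt).sitesPerDir (k i)) fun j =>
              ιA (pts (k i) (Λ i)) (T i) X ⟨j.1, j.2⟩ a)| ≤ Cerr i * ‖X‖ ^ 2)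
    (hsm : ∀ i, Cerr i ≤ (4 / Real.pi ^ 2) ^ ((F.P Kt).d + 2) / (2 * (3 * (K i : ℝ) ^ 2 + 2 * (K i : ℝ) ^ 4)))
    (hγle : ∀ i, γ / (M i) ^ 5 ≤ (4 / Real.pi ^ 2) ^ ((F.P Kt).d + 2) / (2 * (3 * (K i : ℝ) ^ 2 + 2 * (K i : ℝ) ^ 4)))
    -- the geometric letter: the k-blocks over the bonds meeting `Λ^{(k)}` lie inside `Ω₁(Z)` (print: `Λ` deep inside `Z`)
    (hfar : ∀ i (b : PBond (F.P Kt) 0), b.src ∉ maxDomT ν.M₁ (Z i) 1 →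
      (⟨blockIter (k i) b.src, b.dir⟩ : PBond (F.P Kt) (k i)) ∉ bondsOf (pts (k i) (Λ i)))
    -- geometry of `Z` and of its maximal sequence (2.13): `Z` a union of `k`-blocks; the (7) ranges of `{Ω_n(Z)}` lie inside `Z` (replace (Vn))
    (hZblk : ∀ i, IsBlockUnion (k i) (Z i))
    (hR0 : ∀ i, Node00.Sect2.printedPlaqsTop (maxDomT ν.M₁ (Z i)) (Node00.suppDomOfRecord F ν Kt (maxDomT ν.M₁ (Z i))) (k i) ⊆
      plaqsInside (Z i))
    (hRsucc : ∀ i m, m + 1 ≤ k i → Node00.Sect2.printedPlaqs (maxDomT ν.M₁ (Z i)) (k i) (m + 1) ⊆ plaqsInside (pts (m + 1) (Z i)))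
    -- bookkeeping constants (replace (Vn)'s `cA`)
    {cE B₃ a₁' cA : ℝ} (hcE0 : 0 ≤ cE) (hcE : ∀ i, 12 * ((F.P Kt).d : ℝ) * ((n i : ℝ) + 2) ^ 2 ≤ cE) (hB₃ : 0 ≤ B₃)
    (heRa : ∀ i, (cE + 1) * eR i ≤ a₁' ∧ B₃ * ((cE + 1) * eR i) ≤ ν.εreg)
    (hcA : 1 / 2 * (B₃ * (cE + 1) * (F.P Kt).eta 1 ^ 2) ^ 2 * (Fintype.card (Plaq (F.P Kt) 0) : ℝ) ≤ cA)
    -- [15] THEOREM 1 (R) AT `Z`'S SEQUENCE (instance-level letter replacing (Vn); see `nearValue_letter_of_thm1AtZSeq`)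
    (h15Z : ∀ i (δ : ℕ → ℝ), (∀ j, j ≤ k i → 0 < δ j ∧ δ j ≤ a₁' ∧ B₃ * δ j ≤ ν.εreg) → (∀ j, j < k i → δ j ≤ 2 * δ (j + 1)) →
      (∀ j, j < k i → δ (j + 1) ≤ 2 * δ j) →
      ∀ W : MSField (F.P Kt) SU2,
        Node00.Sect2.DataSmall7PTop (Node00.avOfRecord F 2 Kt) (maxDomT ν.M₁ (Z i)) (Node00.suppDomOfRecord F ν Kt (maxDomT ν.M₁ (Z i))) (k i) δ W →
        ∀ U₀ : GaugeField (F.P Kt) 0 SU2, IsMinimizer (Node00.avOfRecord F 2 Kt)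
            {U | (∀ j, j ≤ k i → PlaqSmallOn (Node00.Sect2.omegaPlaqsTop (maxDomT ν.M₁ (Z i)) (Node00.suppDomOfRecord F ν Kt (maxDomT ν.M₁ (Z i))) j)
                ((ν.εreg : ℝ) * (F.P Kt).eta j ^ 2) U) ∧
              Node00.Sect2.CoDivClassOnTop (maxDomT ν.M₁ (Z i)) (Node00.suppDomOfRecord F ν Kt (maxDomT ν.M₁ (Z i))) (k i) ν.εreg U}
            (genSet (maxDomT ν.M₁ (Z i)) (k i)) W U₀ →
          (∀ j, j ≤ k i → PlaqSmallOn (Node00.Sect2.omegaPlaqsTop (maxDomT ν.M₁ (Z i)) (Node00.suppDomOfRecord F ν Kt (maxDomT ν.M₁ (Z i))) j)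
              (B₃ * δ j * (F.P Kt).eta j ^ 2) U₀) ∧
            ∀ j, j ≤ k i → Node00.Sect2.CoDivSmallOn (Node00.Sect2.omegaBondsTop (maxDomT ν.M₁ (Z i)) (Node00.suppDomOfRecord F ν Kt (maxDomT ν.M₁ (Z i))) j)
              (B₃ * δ j * (F.P Kt).eta j ^ 3) U₀)
    (hcJ' : ∀ i, 2 * cA * eR i / R i + 4 * 𝓐 i / (R i * eR i) ≤ cJ)
    : ∃ a₁ : ι → ℝ, (∀ i, 0 < a₁ i) ∧
      B15.Prop1Printed (lfVarOn su2Chart fun i =>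
        InstOn.std (Node00.bgMSCoPOfRecord F 2 ν Kt (k i) (maxDomT ν.M₁ (Z i))) ν.M₁ (Z i) (Λ i) (k i) (M i) (a₁ i)
          (anExt (pts (k i) (Λ i)) (T i)
            (fun177std (Node00.bgMSCoPOfRecord F 2 ν Kt (k i) (maxDomT ν.M₁ (Z i))) ν.M₁ (Z i) (k i)) (ext i)
            (min (1 / 2) (min (R i / 8) (γ / (M i) ^ 5 * (R i / 2) ^ 2 / (48 * (4 * 𝓐 i / R i + 1))))))) :=
  exists_domain_prop1Printed_lfVarOn_std_su2_box_intrinsic_analytic_atZSeqCoPRecord_ofNearValue ν Kt hd3 h0 hcl Z Λ k M hk0 hk eR heR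
    T lo hi n hn hN hbox hZ hTG0 hN5 K hK1 hKn ext hext hlohi hγ hcJ hbx hbxM hM hR h𝓐 n' hn' hGj hlead hsm hγle hfar
    (nearValue_letter_of_thm1AtZSeq ν Kt hd3 Z Λ k hk0 hk eR lo hi n hn hbox hZ hN5 ext hext hlohi hZblk hR0 hRsucc hcE0 hcE hB₃ heRa
      hcA h15Z) hcJ'

end Endpoint

/-! ## §7 Non-vacuity of the geometric letters at `Z = T_η` (the whole torus: `Ω_n(T_η) = T_η`, `B14.Eq213DetSet.maxDomT_univ`) -/

section NonVacuity

variable {P : Params}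

/-- (Gᵃ) at `Z = T_η`: the whole torus is a union of `k`-blocks. [cite: Balaban1988Convergent, (2.1) p.255 (bookkeeping)] -/
theorem isBlockUnion_univ (k : ℕ) : IsBlockUnion k (Set.univ : Set (Site P 0)) := fun _ => by
  simp only [Set.mem_univ]

/-- (Gᵇ), level `0`, at `Z = T_η`: every set of fine plaquettes lies inside `T_η`. [cite: Balaban1985Variational, (7) p.278 (bookkeeping)] -/
theorem subset_plaqsInside_univ (S : Set (Plaq P 0)) : S ⊆ plaqsInside (Set.univ : Set (Site P 0)) := fun _ _ =>
  ⟨Set.mem_univ _, Set.mem_univ _, Set.mem_univ _, Set.mem_univ _⟩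

/-- (Gᵇ), levels `j ≥ 1`, at `Z = T_η`: every set of scale-`j` plaquettes lies inside `T_η^{(j)}`. [cite: Balaban1985Variational, (7) p.278 (bookkeeping)] -/
theorem subset_plaqsInside_pts_univ {j : ℕ} (S : Set (Plaq P j)) : S ⊆ plaqsInside (pts j (Set.univ : Set (Site P 0))) := fun _ _ =>
  ⟨Set.mem_univ _, Set.mem_univ _, Set.mem_univ _, Set.mem_univ _⟩

end NonVacuity

/-! ## §8 The geometric letters (Gᵇ) DISCHARGED: the (7) ranges of the maximal sequence of a region lie inside the region ([III] (2.13) p. 256: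
«dist(Ω_n, Ωᶜ_{n−1}) ≧ LⁿξM₁», r11's `B14.Eq213DetSet.dist_maxDomT`) -/

section ZRanges

open B15Eq112TorusCover (cover lift per cover_apply cover_lift cover_eq_cover_iff cover_add_pmul)
open B14DomainGeom (Pt Within)
open B15LatticeCubeTorus (pmul)
open B14.Eq213MaximalDomains (side cubeExt)
open B14.Eq213DetSet (maxDomT maxDomT_zero maxDomT_subset dist_maxDomT)

variable {P : Params}

/-- `ι_j (y + a) = ι_j y + L^j·a`: the iterated centre embedding intertwines translations of `T^{(j)}` with the scaled translations of `T_η`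
(`T4Covariance`'s `Site.emb_add` ∕ `Site.scaleTo`, iterated). [cite: Balaban1987RG1, (0.1) p.251] -/
theorem embIter_add : ∀ (j : ℕ) (y a : Site P j), embIter j (y + a) = embIter j y + Site.scaleTo j a
  | 0, _, _ => rfl
  | j + 1, y, a => by
    show embIter j (emb (y + a)) = embIter j (emb y) + Site.scaleTo (j + 1) a
    rw [Site.emb_add, embIter_add j, Site.scaleTo_succ]

/-- `ι_j (c + e_μ) = ι_j c + L^j e_μ` in `T_η`, in coordinates (iterating `T4Continuum.emb_shift_apply`; `T4UndoubledRP.scaleTo_update`).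
[cite: Balaban1987RG1, (0.1) p.251] -/
theorem embIter_shift_apply (j : ℕ) (c : Site P j) (μ ν : Fin P.d) :
    embIter j (c.shift μ) ν = embIter j c ν + (if ν = μ then ((P.L ^ j : ℕ) : ZMod (P.sitesPerDir 0)) else 0) := by
  rw [← Site.add_zero_shift, embIter_add, Site.add_apply]
  have h : (0 : Site P j).shift μ = Function.update (0 : Site P j) μ ((1 : ℕ) : ZMod (P.sitesPerDir j)) := by
    show Function.update (0 : Site P j) μ ((0 : Site P j) μ + 1) = _
    rw [Site.zero_apply, zero_add, Nat.cast_one]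
  rw [h, T4UndoubledRP.scaleTo_update, one_mul]
  by_cases hν : ν = μ
  · subst hν; rw [Function.update_self, if_pos rfl]
  · rw [Function.update_of_ne hν, if_neg hν, Site.zero_apply]

/-- **A `T^{(j)}`-STEP ON THE COVER**: if `x ∈ ℤᵈ` covers the centre `ι_j c`, then `x + L^j e_μ` covers `ι_j (c + e_μ)` — the non-wrapping
representative of the neighbouring centre. [cite: Balaban1987RG1, (0.1) p.251] -/
theorem cover_add_single_pow (j : ℕ) {x : Pt P.d} {c : Site P j} (hx : cover P x = embIter j c) (μ : Fin P.d) :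
    cover P (x + Pi.single μ ((P.L ^ j : ℕ) : ℤ)) = embIter j (c.shift μ) := by
  funext ν
  have hxν : ((x ν : ℤ) : ZMod (P.sitesPerDir 0)) = embIter j c ν := by rw [← cover_apply, hx]
  rw [cover_apply, Pi.add_apply, Int.cast_add, hxν, embIter_shift_apply]
  by_cases hν : ν = μ
  · subst hν; rw [Pi.single_eq_same, if_pos rfl, Int.cast_natCast]
  · rw [Pi.single_eq_of_ne hν, if_neg hν, Int.cast_zero]

/-- Sup-distance `≤ t` between any two corners `x + a e_μ + b e_ν`, `a, b ∈ {0, t}`, `μ ≠ ν`. [folklore] -/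
private theorem within_corner {d : ℕ} (x : Pt d) {μ ν : Fin d} (hne : μ ≠ ν) {t : ℤ} (ht : 0 ≤ t) {a b a' b' : ℤ}
    (ha : a = 0 ∨ a = t) (hb : b = 0 ∨ b = t) (ha' : a' = 0 ∨ a' = t) (hb' : b' = 0 ∨ b' = t) :
    Within t (x + Pi.single μ a + Pi.single ν b) (x + Pi.single μ a' + Pi.single ν b') := by
  intro i
  simp only [Pi.add_apply]
  rw [abs_le]
  by_cases hμ : i = μ
  · subst hμ
    rw [Pi.single_eq_same, Pi.single_eq_same, Pi.single_eq_of_ne hne, Pi.single_eq_of_ne hne]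
    rcases ha with ha | ha <;> rcases ha' with ha' | ha' <;> constructor <;> linarith
  · by_cases hν : i = ν
    · subst hν
      rw [Pi.single_eq_same, Pi.single_eq_same, Pi.single_eq_of_ne hμ, Pi.single_eq_of_ne hμ]
      rcases hb with hb | hb <;> rcases hb' with hb' | hb' <;> constructor <;> linarith
    · rw [Pi.single_eq_of_ne hμ, Pi.single_eq_of_ne hμ, Pi.single_eq_of_ne hν, Pi.single_eq_of_ne hν]
      constructor <;> linarith

/-- Weakening the radius of `Within`. [folklore] -/
private theorem within_mono {d : ℕ} {r r' : ℤ} (h : r ≤ r') {x y : Pt d} (hw : Within r x y) : Within r' x y :=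
  fun i => (hw i).trans h

/-- For `j ≥ 1` the member `Γ_j` of the determining set of a sequence lies in `Ω_j^{(j)}`. [cite: Balaban1988Convergent, (2.2) p.255] -/
theorem genSet_subset_pts_of_one_le (Ω : ℕ → Set (Site P 0)) (k : ℕ) {j : ℕ} (hj : 1 ≤ j) : genSet Ω k j ⊆ pts j (Ω j) := by
  intro y hy
  simp only [genSet, mem_pts, gammaRegion] at hy ⊢
  split_ifs at hy with h1 h2 h3
  · exact absurd hy (Set.notMem_empty _)
  · subst h2; exact hy
  · omega
  · exact hy.1

/-- ★★ **(Gᵇ), LEVELS `j ≥ 1`: THE (7) PLAQUETTES OF `Z`'S MAXIMAL SEQUENCE AT SCALE `j` LIE INSIDE `Z^{(j)}`** — a scale-`j` plaquette touching `Γ_j ⊆ Ω_j(Z)^{(j)}`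
has all four centres within sup-distance `L^j ≤ LʲM₁ − 1` (`M₁ ≥ 2`) of a centre in `Ω_j(Z)`, hence in `Ω_{j−1}(Z) ⊆ Z` by the printed distance condition
*«dist(Ω_n, Ωᶜ_{n−1}) ≧ LⁿξM₁»* (r11's `dist_maxDomT`, divisibility `LᴶM₁ ∣ 2L^{m+K}` for the torus partition, `j ≤ J`).
[cite: Balaban1988Convergent, (2.13) pp.256–257, (2.2) p.255; Balaban1985Variational, (7) p.278] -/
theorem printedPlaqs_maxDomT_subset_plaqsInside {M₁ : ℕ} (hM2 : 2 ≤ M₁) {Z : Set (Site P 0)} {J : ℕ}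
    (hdiv : side P.L M₁ J ∣ P.sitesPerDir 0) (k : ℕ) {j : ℕ} (hj1 : 1 ≤ j) (hjJ : j ≤ J) :
    Node00.Sect2.printedPlaqs (maxDomT M₁ Z) k j ⊆ plaqsInside (pts j Z) := by
  intro p hp
  have hM : 1 ≤ M₁ := le_trans (by norm_num) hM2
  obtain ⟨n, rfl⟩ : ∃ n, j = n + 1 := ⟨j - 1, by omega⟩
  have hp' : p ∈ plaqsOf (pts (n + 1) (maxDomT M₁ Z (n + 1))) :=
    plaqsOf_mono (genSet_subset_pts_of_one_le _ k hj1) (Node00.Sect2.printedPlaqs_subset_plaqsOf _ _ _ hp)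
  -- the four centres on the cover
  set t : ℤ := ((P.L ^ (n + 1) : ℕ) : ℤ) with ht
  have ht0 : 0 ≤ t := by rw [ht]; exact_mod_cast Nat.zero_le _
  set x : Pt P.d := lift P (embIter (n + 1) p.src) with hxdef
  let q : ℤ → ℤ → Pt P.d := fun a b => x + Pi.single p.μ a + Pi.single p.ν b
  have hq00 : cover P (q 0 0) = embIter (n + 1) p.src := by
    show cover P (x + Pi.single p.μ 0 + Pi.single p.ν 0) = _
    rw [Pi.single_zero, Pi.single_zero, add_zero, add_zero, hxdef, cover_lift]
  have hqt0 : cover P (q t 0) = embIter (n + 1) (p.src.shift p.μ) := by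
    show cover P (x + Pi.single p.μ t + Pi.single p.ν 0) = _
    rw [Pi.single_zero, add_zero, ht, cover_add_single_pow (n + 1) (by rw [hxdef, cover_lift]) p.μ]
  have hq0t : cover P (q 0 t) = embIter (n + 1) (p.src.shift p.ν) := by
    show cover P (x + Pi.single p.μ 0 + Pi.single p.ν t) = _
    rw [Pi.single_zero, add_zero, ht, cover_add_single_pow (n + 1) (by rw [hxdef, cover_lift]) p.ν]
  have hqtt : cover P (q t t) = embIter (n + 1) ((p.src.shift p.μ).shift p.ν) := by
    show cover P (x + Pi.single p.μ t + Pi.single p.ν t) = _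
    rw [ht, cover_add_single_pow (n + 1) _ p.ν]
    rw [cover_add_single_pow (n + 1) (by rw [hxdef, cover_lift]) p.μ]
  -- one corner lies in `Ω_{n+1}(Z)`
  have hne : p.μ ≠ p.ν := ne_of_lt p.hμν
  have h0 : ∃ a b, (a = 0 ∨ a = t) ∧ (b = 0 ∨ b = t) ∧ cover P (q a b) ∈ maxDomT M₁ Z (n + 1) := by
    rcases hp' with h | h | h | h
    · exact ⟨0, 0, Or.inl rfl, Or.inl rfl, by rw [hq00]; exact h⟩
    · exact ⟨t, 0, Or.inr rfl, Or.inl rfl, by rw [hqt0]; exact h⟩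
    · exact ⟨0, t, Or.inl rfl, Or.inr rfl, by rw [hq0t]; exact h⟩
    · exact ⟨t, t, Or.inr rfl, Or.inr rfl, by rw [hqtt]; exact h⟩
  obtain ⟨a₀, b₀, ha₀, hb₀, hmem⟩ := h0
  -- every corner is within `LʲM₁ − 1` of it, hence in `Ω_n(Z) ⊆ Z`
  have hrad : t ≤ (side P.L M₁ (n + 1) : ℤ) - 1 := by
    have h1 : (side P.L M₁ (n + 1) : ℤ) = t * M₁ := by rw [ht]; simp [side, Nat.cast_mul, Nat.cast_pow]
    have h2 : (2 : ℤ) ≤ M₁ := by exact_mod_cast hM2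
    have h3 : 1 ≤ t := by rw [ht]; exact_mod_cast Nat.one_le_pow _ _ P.L_pos
    nlinarith
  have H : ∀ a b, (a = 0 ∨ a = t) → (b = 0 ∨ b = t) → cover P (q a b) ∈ Z := fun a b ha hb =>
    maxDomT_subset hM Z n (dist_maxDomT hM hdiv hjJ hmem (within_mono hrad (within_corner x hne ht0 ha₀ hb₀ ha hb)))
  refine ⟨?_, ?_, ?_, ?_⟩
  · rw [mem_pts, ← hq00]; exact H 0 0 (Or.inl rfl) (Or.inl rfl)
  · rw [mem_pts, ← hqt0]; exact H t 0 (Or.inr rfl) (Or.inl rfl)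
  · rw [mem_pts, ← hq0t]; exact H 0 t (Or.inl rfl) (Or.inr rfl)
  · rw [mem_pts, ← hqtt]; exact H t t (Or.inr rfl) (Or.inr rfl)

/-- ★★ **(Gᵇ), LEVEL `0`: THE (7) PLAQUETTES OF THE TOP DOMAIN = SUPPORT `Ω₁(Z) +` ONE LAYER OF `M₁`-CUBES LIE INSIDE `Z`** — a fine plaquette meeting the
support of record `hullD … M₁ 1 (Ω₁(Z))` ([III] p. 255 *«a small neighborhood of Ω₁ including a layer of M₁-cubes»*) has all four corners within sup-distance
`2M₁ ≤ LM₁ − 1` (`L ≥ 3`) of a point of `Ω₁(Z)`, hence in `Ω₀(Z) = Z` by *«dist(Ω₁, Ωᶜ₀) ≧ LξM₁»* (r11's `dist_maxDomT`; divisibility `LᴶM₁ ∣ 2L^{m+K}`, `1 ≤ J`).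
[cite: Balaban1988Convergent, p.255, (2.13) pp.256–257; Balaban1985Variational, (3),(7) p.278] -/
theorem printedPlaqsTop_maxDomT_subset_plaqsInside {M₁ : ℕ} (hM : 1 ≤ M₁) {Z : Set (Site P 0)} {J : ℕ}
    (hdiv : side P.L M₁ J ∣ P.sitesPerDir 0) (hJ : 1 ≤ J) (k : ℕ) :
    Node00.Sect2.printedPlaqsTop (maxDomT M₁ Z) (Node00.hullD P M₁ 1 (maxDomT M₁ Z 1)) k ⊆ plaqsInside Z := by
  intro p hp
  have hp' : p ∈ plaqsOf (Node00.hullD P M₁ 1 (maxDomT M₁ Z 1)) := hp.2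
  -- the four corners on the cover
  set x : Pt P.d := lift P p.src with hxdef
  let q : ℤ → ℤ → Pt P.d := fun a b => x + Pi.single p.μ a + Pi.single p.ν b
  have hstep : ∀ {y : Pt P.d} {c : Site P 0}, cover P y = c → ∀ μ, cover P (y + Pi.single μ 1) = c.shift μ := by
    intro y c hy μ
    have h := cover_add_single_pow (P := P) 0 (c := c) hy μ
    rwa [pow_zero] at h
  have hq00 : cover P (q 0 0) = p.src := by
    show cover P (x + Pi.single p.μ 0 + Pi.single p.ν 0) = _
    rw [Pi.single_zero, Pi.single_zero, add_zero, add_zero, hxdef, cover_lift]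
  have hq10 : cover P (q 1 0) = p.src.shift p.μ := by
    show cover P (x + Pi.single p.μ 1 + Pi.single p.ν 0) = _
    rw [Pi.single_zero, add_zero, hstep (by rw [hxdef, cover_lift]) p.μ]
  have hq01 : cover P (q 0 1) = p.src.shift p.ν := by
    show cover P (x + Pi.single p.μ 0 + Pi.single p.ν 1) = _
    rw [Pi.single_zero, add_zero, hstep (by rw [hxdef, cover_lift]) p.ν]
  have hq11 : cover P (q 1 1) = (p.src.shift p.μ).shift p.ν := by
    show cover P (x + Pi.single p.μ 1 + Pi.single p.ν 1) = _
    rw [hstep _ p.ν]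
    rw [hstep (by rw [hxdef, cover_lift]) p.μ]
  have hne : p.μ ≠ p.ν := ne_of_lt p.hμν
  -- one corner lies in the support: in an `M₁`-cube whose one-layer collar meets `Ω₁(Z)`
  have h0 : ∃ a b, (a = 0 ∨ a = 1) ∧ (b = 0 ∨ b = 1) ∧ cover P (q a b) ∈ Node00.hullD P M₁ 1 (maxDomT M₁ Z 1) := by
    rcases hp' with h | h | h | h
    · exact ⟨0, 0, Or.inl rfl, Or.inl rfl, by rw [hq00]; exact h⟩
    · exact ⟨1, 0, Or.inr rfl, Or.inl rfl, by rw [hq10]; exact h⟩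
    · exact ⟨0, 1, Or.inl rfl, Or.inr rfl, by rw [hq01]; exact h⟩
    · exact ⟨1, 1, Or.inr rfl, Or.inr rfl, by rw [hq11]; exact h⟩
  obtain ⟨a₀, b₀, ha₀, hb₀, hmem⟩ := h0
  classical
  simp only [Node00.hullD, Set.mem_iUnion, Finset.mem_filter] at hmem
  obtain ⟨a, ⟨_, ⟨z, hz1, hzΩ⟩⟩, hc⟩ := hmem
  -- lifts: the corner `ĉ` in the cube, the witness `ẑ` in its collar
  simp only [Node00.cubeEnl, Set.mem_image] at hz1 hc
  obtain ⟨zh, hzh, rfl⟩ := hz1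
  obtain ⟨ch, hch, hcq⟩ := hc
  -- re-centre the deck translation between `ch` and `q a₀ b₀`
  obtain ⟨v, hv⟩ := (cover_eq_cover_iff (q a₀ b₀) ch).1 hcq.symm
  set zh' : Pt P.d := zh - pmul (per P) v with hzh'
  have hzcov : cover P zh' ∈ maxDomT M₁ Z (0 + 1) := by
    have : zh = zh' + pmul (per P) v := by rw [hzh', sub_add_cancel]
    rw [this, cover_add_pmul] at hzΩ
    exact hzΩ
  -- sup-distance from `zh'` to every corner ≤ 2M₁ ≤ LM₁ − 1
  have hL3 : (3 : ℤ) ≤ P.L := by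
    have h1 := P.hL.2
    obtain ⟨r, hr⟩ := P.hL.1
    omega
  have hM' : (1 : ℤ) ≤ M₁ := by exact_mod_cast hM
  have hW : ∀ a b, (a = 0 ∨ a = 1) → (b = 0 ∨ b = 1) → Within ((side P.L M₁ (0 + 1) : ℤ) - 1) zh' (q a b) := by
    intro a b ha hb i
    have hside : (side P.L M₁ (0 + 1) : ℤ) = P.L * M₁ := by simp [side, Nat.cast_mul]
    rw [hside]
    have hcorner := within_corner x hne (zero_le_one) ha₀ hb₀ ha hb i
    have hz := hzh i
    have hc' := hch i
    have hvq : ch i = (q a₀ b₀) i + (pmul (per P) v) i := by rw [hv]; rfl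
    have hz' : zh' i = zh i - (pmul (per P) v) i := by rw [hzh']; rfl
    rw [hz']
    have e1 : |zh i - ch i| ≤ 2 * (M₁ : ℤ) - 1 := by
      rw [abs_le]; push_cast at hz hc' ⊢; constructor <;> nlinarith [hz.1, hz.2, hc'.1, hc'.2]
    calc |zh i - (pmul (per P) v) i - (q a b) i|
        = |(zh i - ch i) + ((q a₀ b₀) i - (q a b) i)| := by rw [hvq]; ring_nf
      _ ≤ |zh i - ch i| + |(q a₀ b₀) i - (q a b) i| := abs_add_le _ _
      _ ≤ (2 * (M₁ : ℤ) - 1) + 1 := add_le_add e1 hcorner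
      _ ≤ P.L * M₁ - 1 := by nlinarith
  have H : ∀ a b, (a = 0 ∨ a = 1) → (b = 0 ∨ b = 1) → cover P (q a b) ∈ Z := fun a b ha hb => by
    have h := dist_maxDomT hM hdiv hJ hzcov (hW a b ha hb)
    rwa [maxDomT_zero] at h
  refine ⟨?_, ?_, ?_, ?_⟩
  · rw [← hq00]; exact H 0 0 (Or.inl rfl) (Or.inl rfl)
  · rw [← hq10]; exact H 1 0 (Or.inr rfl) (Or.inl rfl)
  · rw [← hq01]; exact H 0 1 (Or.inl rfl) (Or.inr rfl)
  · rw [← hq11]; exact H 1 1 (Or.inr rfl) (Or.inr rfl)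

end ZRanges

/-! ## §9 The endpoint with the geometric letters (Gᵇ) DISCHARGED (§8): `M₁ ≥ 2` and the torus divisibility instead -/

section EndpointGeom

open Classical
open Metric
open scoped BigOperators RealInnerProductSpace InnerProductSpace
open B14.Eq213DetSet B15Sect1Instances B16Sect1Wilson B16Sect1Backgrounds B15Prop1GradientFromNearValue B15Prop1GradientFromNearValueAtCoPRecord
open B15Prop1AtZSequenceRecord B15Prop1SliceTaylorCalculus B15Prop1IntrinsicOfFun
open B15Prop1AnalyticExtClause (cplxVec cplxSlice anExt)
open B15Prop1ChartCalculusSU2 (E3)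
open T4CubeChartGnomonic (SU2)
open B15Prop1ChartSU2 (su2Chart)
open B15Prop1SliceCoordinates (GaugeSlice ιA freeBonds)
open T4AxialGaugeSmallField (castSite boxPlaqs)
open B6BondElimination (unitVec)
open B16Eq18Proof (box)
open B15Extension193 (extend)
open B15ShellGauge193 (shellGauge)
open B15ShellGauge193Local (dist1_plaqHol_extend_shellGauge_le)
open B5Bounds167Lattice (formDk ofRealCfg)
open B14.Eq213MaximalDomains (side)
open T4Continuum

/-- ★★★ **THE NEAR-VALUE LETTER (Vn) AT PRINT'S (1.74) OBJECT FROM [15] THEOREM 1 (R) AT `Z`'S SEQUENCE — GEOMETRY DISCHARGED**: `nearValue_letter_of_thm1AtZSeq`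
with the range letters (Gᵇ) `hR0`∕`hRsucc` REPLACED by print's `M₁ ≥ 2` and the torus divisibility `L^{k}M₁ ∣ 2L^{m+K}` (§8
`printedPlaqsTop_maxDomT_subset_plaqsInside`, `printedPlaqs_maxDomT_subset_plaqsInside`).  Letters left: (Gᵃ) `hZblk`, bookkeeping, `h15Z`.
[cite: Balaban1989LargeFieldI, (1.74) p.192, p.193 L14–20; Balaban1985Variational, (2),(6),(7) p.278, Thm 1 (8) p.279; Balaban1988Convergent, p.255, (2.12)–(2.13)
pp.256–257, (2.16) p.257] -/
theorem nearValue_letter_of_thm1AtZSeq_geom {F : T4Family} (ν : Node00.Stage7Numerics) (Kt : ℕ) (hd3 : 3 ≤ (F.P Kt).d) {ι : Type}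
    (Z Λ : ι → Set (Site (F.P Kt) 0)) (k : ι → ℕ) (hk0 : ∀ i, 0 < k i) (hk : ∀ i, k i ≤ (F.P Kt).m + (F.P Kt).K)
    (eR : ι → ℝ)
    (lo hi : ι → Fin (F.P Kt).d → ℤ) (n : ι → ℕ) (hn : ∀ i κ, hi i κ ≤ lo i κ + n i)
    (hbox : ∀ i, pts (k i) (Λ i) = (castSite '' Set.Icc (lo i) (hi i) : Set (Site (F.P Kt) (k i))))
    (hZ : ∀ i, (boxPlaqs (lo i - 1) (hi i + 1) : Set (Plaq (F.P Kt) (k i))) ⊆ plaqsInside (pts (k i) (Z i)))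
    (hN5 : ∀ i κ, ((hi i κ - lo i κ + 1).toNat : ℤ) + 5 < (F.P Kt).sitesPerDir (k i))
    (ext : ∀ i, GaugeField (F.P Kt) (k i) SU2 → GaugeField (F.P Kt) (k i) SU2)
    (hext : ∀ i Vk, ext i Vk = extend (pts (k i) (Λ i)) (shellGauge Vk (lo i) (hi i)) Vk)
    (hlohi : ∀ i, lo i ≤ hi i)
    -- geometry of `Z`: a union of `k`-blocks (print's `Z` is a union of `M`-cubes of `T₁^{(k)}`)
    (hZblk : ∀ i, IsBlockUnion (k i) (Z i))
    -- (Gᵇ) DISCHARGED (§8): print's `M₁ ≥ 2` and the torus divisibility `L^{k}M₁ ∣ 2L^{m+K}` of the `LʲM₁`-cube partitions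
    (hM2 : 2 ≤ ν.M₁) (hdiv : ∀ i, side (F.P Kt).L ν.M₁ (k i) ∣ (F.P Kt).sitesPerDir 0)
    -- bookkeeping constants
    {cE B₃ a₁ cA : ℝ} (hcE0 : 0 ≤ cE) (hcE : ∀ i, 12 * ((F.P Kt).d : ℝ) * ((n i : ℝ) + 2) ^ 2 ≤ cE) (hB₃ : 0 ≤ B₃)
    (heRa : ∀ i, (cE + 1) * eR i ≤ a₁ ∧ B₃ * ((cE + 1) * eR i) ≤ ν.εreg)
    (hcA : 1 / 2 * (B₃ * (cE + 1) * (F.P Kt).eta 1 ^ 2) ^ 2 * (Fintype.card (Plaq (F.P Kt) 0) : ℝ) ≤ cA)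
    -- [15] THEOREM 1 (R) AT `Z`'S SEQUENCE `{Ω_n(Z)} = maxDomT ν.M₁ Z` (instance-level letter; the body of `Node00.VariationalThm1RegSepTop7M` at
    -- `s.Ω := maxDomT ν.M₁ (Z i)`, `Sup := suppDomOfRecord`, `ε₀ := ν.εreg`, separation ∕ `0 < M₁` ∕ `εreg ≤ a₀` discharged by the consumer)
    (h15Z : ∀ i (δ : ℕ → ℝ), (∀ j, j ≤ k i → 0 < δ j ∧ δ j ≤ a₁ ∧ B₃ * δ j ≤ ν.εreg) → (∀ j, j < k i → δ j ≤ 2 * δ (j + 1)) →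
      (∀ j, j < k i → δ (j + 1) ≤ 2 * δ j) →
      ∀ W : MSField (F.P Kt) SU2,
        Node00.Sect2.DataSmall7PTop (Node00.avOfRecord F 2 Kt) (maxDomT ν.M₁ (Z i)) (Node00.suppDomOfRecord F ν Kt (maxDomT ν.M₁ (Z i))) (k i) δ W →
        ∀ U₀ : GaugeField (F.P Kt) 0 SU2, IsMinimizer (Node00.avOfRecord F 2 Kt)
            {U | (∀ j, j ≤ k i → PlaqSmallOn (Node00.Sect2.omegaPlaqsTop (maxDomT ν.M₁ (Z i)) (Node00.suppDomOfRecord F ν Kt (maxDomT ν.M₁ (Z i))) j)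
                ((ν.εreg : ℝ) * (F.P Kt).eta j ^ 2) U) ∧
              Node00.Sect2.CoDivClassOnTop (maxDomT ν.M₁ (Z i)) (Node00.suppDomOfRecord F ν Kt (maxDomT ν.M₁ (Z i))) (k i) ν.εreg U}
            (genSet (maxDomT ν.M₁ (Z i)) (k i)) W U₀ →
          (∀ j, j ≤ k i → PlaqSmallOn (Node00.Sect2.omegaPlaqsTop (maxDomT ν.M₁ (Z i)) (Node00.suppDomOfRecord F ν Kt (maxDomT ν.M₁ (Z i))) j)
              (B₃ * δ j * (F.P Kt).eta j ^ 2) U₀) ∧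
            ∀ j, j ≤ k i → Node00.Sect2.CoDivSmallOn (Node00.Sect2.omegaBondsTop (maxDomT ν.M₁ (Z i)) (Node00.suppDomOfRecord F ν Kt (maxDomT ν.M₁ (Z i))) j)
              (B₃ * δ j * (F.P Kt).eta j ^ 3) U₀)
    : ∀ i ε Vk, 0 < ε → ε ≤ eR i → PlaqSmallOn (plaqsInside (pts (k i) (Z i ∩ (Λ i)ᶜ))) ε Vk →
      wilsonLoc ((plaqsOf (maxDomT ν.M₁ (Z i) 1)).indicator fun _ => (1 : ℝ))
        (bgKZstd (Node00.bgMSCoPOfRecord F 2 ν Kt (k i) (maxDomT ν.M₁ (Z i))) ν.M₁ (Z i) (k i) (ext i Vk)) ≤ cA * ε ^ 2 :=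
  nearValue_letter_of_thm1AtZSeq ν Kt hd3 Z Λ k hk0 hk eR lo hi n hn hbox hZ hN5 ext hext hlohi hZblk
    (fun i => printedPlaqsTop_maxDomT_subset_plaqsInside (le_trans one_le_two hM2) (hdiv i) (hk0 i) (k i))
    (fun i m hm => printedPlaqs_maxDomT_subset_plaqsInside hM2 (hdiv i) (k i) (Nat.succ_le_succ (Nat.zero_le m)) hm)
    hcE0 hcE hB₃ heRa hcA h15Z

/-- ★★★ **PROPOSITION 1 [IV] WITH ITS ANALYTIC-EXTENSION CLAUSE AT PRINT'S (1.74) OBJECT, (Vn) FROM [15] THEOREM 1 (R) AT `Z`'S SEQUENCE, GEOMETRY DISCHARGED** —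
§6's endpoint with (Gᵇ) replaced by `2 ≤ ν.M₁` and `L^{k_i}M₁ ∣ 2L^{m+K}`.  WHAT A CONSUMER SUPPLIES per instance: (J1) `hGj`, (L2) `hlead` + `hsm`∕`hγle`, `h15Z`
([15] Thm 1 (R) at `Z`'s sequence — NODE 00's), `hfar`, (Gᵃ) `hZblk`, `0 < k i ≤ m + K`, structure, numerics (`hcE`∕`heRa`∕`hB₃`∕`hcA`∕`hcJ'`), `hM2`, `hdiv`,
`hcl := Subsingleton.elim _ _`.
[cite: Balaban1989LargeFieldI, (1.74) p.192, Prop. 1 (1.77)–(1.78) p.194 (incl. the last clause), p.193 L14–20; Balaban1988Convergent, p.255, (2.12)–(2.13)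
pp.256–257, (2.16) p.257; Balaban1985Variational, (2),(5),(6),(7) p.278, Thm 1 (8) p.279, Prop. 9 p.309; Balaban1989LargeFieldII, (1.7)–(1.9) p.358, (1.11)
p.358, (1.12)–(1.13) p.359] -/
theorem exists_domain_prop1Printed_lfVarOn_std_su2_box_intrinsic_analytic_atZSeqCoPRecord_ofThm1AtZSeq_geom {F : T4Family}
    (ν : Node00.Stage7Numerics) (Kt : ℕ) (hd3 : 3 ≤ (F.P Kt).d) (h0 : 0 < (F.P Kt).d) {ι : Type}
    [hdec : ∀ j, DecidableEq (PBond (F.P Kt) j)] (hcl : hdec = fun _ a b => Classical.propDecidable (a = b))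
    (Z Λ : ι → Set (Site (F.P Kt) 0)) (k : ι → ℕ) (M : ι → ℝ) (hk0 : ∀ i, 0 < k i) (hk : ∀ i, k i ≤ (F.P Kt).m + (F.P Kt).K)
    (eR : ι → ℝ) (heR : ∀ i, 0 < eR i)
    (T : ∀ i, Finset (PBond (F.P Kt) (k i)))
    (lo hi : ι → Fin (F.P Kt).d → ℤ) (n : ι → ℕ) (hn : ∀ i κ, hi i κ ≤ lo i κ + n i) (hN : ∀ i, n i + 2 < (F.P Kt).sitesPerDir (k i))
    (hbox : ∀ i, pts (k i) (Λ i) = (castSite '' Set.Icc (lo i) (hi i) : Set (Site (F.P Kt) (k i))))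
    (hZ : ∀ i, (boxPlaqs (lo i - 1) (hi i + 1) : Set (Plaq (F.P Kt) (k i))) ⊆ plaqsInside (pts (k i) (Z i)))
    (hTG0 : ∀ i, T i = (box (fun κ => (hi i κ - lo i κ + 1).toNat) (lo i)).image fun x =>
      (⟨castSite (x - unitVec ⟨0, h0⟩), ⟨0, h0⟩⟩ : PBond (F.P Kt) (k i)))
    (hN5 : ∀ i κ, ((hi i κ - lo i κ + 1).toNat : ℤ) + 5 < (F.P Kt).sitesPerDir (k i))
    (K : ι → ℕ) (hK1 : ∀ i, 1 ≤ K i) (hKn : ∀ i κ, (hi i κ - lo i κ + 1).toNat ≤ K i)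
    (ext : ∀ i, GaugeField (F.P Kt) (k i) SU2 → GaugeField (F.P Kt) (k i) SU2)
    (hext : ∀ i Vk, ext i Vk = extend (pts (k i) (Λ i)) (shellGauge Vk (lo i) (hi i)) Vk)
    (hlohi : ∀ i, lo i ≤ hi i)
    {γ cJ bx : ℝ} (hγ : 0 < γ) (hcJ : 0 ≤ cJ) (hbx : 0 ≤ bx)
    (hbxM : ∀ i, 12 * ((F.P Kt).d : ℝ) * ((n i : ℝ) + 2) ^ 2 ≤ bx * (M i) ^ 2)
    {Cerr R 𝓐 : ι → ℝ} (hM : ∀ i, 1 ≤ (M i)) (hR : ∀ i, 0 < R i) (h𝓐 : ∀ i, 0 ≤ 𝓐 i)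
    (n' : ι → ℕ) (hn' : ∀ i, 1 ≤ n' i)
    -- (J1) the JOINT holomorphic extension of print's function in the datum perturbation and the field
    (hGj : ∀ i Vk, PlaqSmallOn (plaqsInside (pts (k i) (Z i ∩ (Λ i)ᶜ))) (eR i) Vk →
      ∃ 𝒢 : VecField (F.P Kt) (k i) (EuclideanSpace ℂ (Fin 3)) × VecField (F.P Kt) (k i) (EuclideanSpace ℂ (Fin 3)) → ℂ,
        DifferentiableOn ℂ 𝒢 (ball 0 (R i)) ∧
        (∀ z ∈ ball (0 : VecField (F.P Kt) (k i) (EuclideanSpace ℂ (Fin 3)) × VecField (F.P Kt) (k i) (EuclideanSpace ℂ (Fin 3))) (R i), ‖𝒢 z‖ ≤ 𝓐 i) ∧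
        ∀ p B' : VecField (F.P Kt) (k i) E3, ‖p‖ < R i → ‖B'‖ < R i →
          𝒢 (cplxVec p, cplxVec B') =
            ((fun177std (Node00.bgMSCoPOfRecord F 2 ν Kt (k i) (maxDomT ν.M₁ (Z i))) ν.M₁ (Z i) (k i)
              (expMul su2Chart B' (ext i (expMul su2Chart p Vk))) : ℝ) : ℂ))
    -- (L2) (1.7)–(1.9) p.358 for the Hessian of the slice function at `0`
    (hlead : ∀ i Vk, PlaqSmallOn (plaqsInside (pts (k i) (Z i ∩ (Λ i)ᶜ))) (eR i) Vk →
      ∀ X : GaugeSlice (pts (k i) (Λ i)) (T i) E3,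
      |⟪X, (fderiv ℝ (rGrad (pts (k i) (Λ i)) (T i)
              (sliceFn (pts (k i) (Λ i)) (T i)
                (fun177std (Node00.bgMSCoPOfRecord F 2 ν Kt (k i) (maxDomT ν.M₁ (Z i))) ν.M₁ (Z i) (k i)) (ext i Vk))) 0) X⟫ -
          ∑ a : Fin 3, formDk (n' i) (fun _ : Fin (F.P Kt).d => (F.P Kt).sitesPerDir (k i))
            (ofRealCfg (fun _ : Fin (F.P Kt).d => (F.P Kt).sitesPerDir (k i)) fun j =>
              ιA (pts (k i) (Λ i)) (T i) X ⟨j.1, j.2⟩ a)| ≤ Cerr i * ‖X‖ ^ 2)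
    (hsm : ∀ i, Cerr i ≤ (4 / Real.pi ^ 2) ^ ((F.P Kt).d + 2) / (2 * (3 * (K i : ℝ) ^ 2 + 2 * (K i : ℝ) ^ 4)))
    (hγle : ∀ i, γ / (M i) ^ 5 ≤ (4 / Real.pi ^ 2) ^ ((F.P Kt).d + 2) / (2 * (3 * (K i : ℝ) ^ 2 + 2 * (K i : ℝ) ^ 4)))
    -- the geometric letter: the k-blocks over the bonds meeting `Λ^{(k)}` lie inside `Ω₁(Z)` (print: `Λ` deep inside `Z`)
    (hfar : ∀ i (b : PBond (F.P Kt) 0), b.src ∉ maxDomT ν.M₁ (Z i) 1 →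
      (⟨blockIter (k i) b.src, b.dir⟩ : PBond (F.P Kt) (k i)) ∉ bondsOf (pts (k i) (Λ i)))
    -- geometry of `Z` and of its maximal sequence (2.13): `Z` a union of `k`-blocks; the (7) ranges of `{Ω_n(Z)}` lie inside `Z` (replace (Vn))
    (hZblk : ∀ i, IsBlockUnion (k i) (Z i))
    -- (Gᵇ) DISCHARGED (§8): print's `M₁ ≥ 2` and the torus divisibility `L^{k}M₁ ∣ 2L^{m+K}` of the `LʲM₁`-cube partitions
    (hM2 : 2 ≤ ν.M₁) (hdiv : ∀ i, side (F.P Kt).L ν.M₁ (k i) ∣ (F.P Kt).sitesPerDir 0)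
    -- bookkeeping constants (replace (Vn)'s `cA`)
    {cE B₃ a₁' cA : ℝ} (hcE0 : 0 ≤ cE) (hcE : ∀ i, 12 * ((F.P Kt).d : ℝ) * ((n i : ℝ) + 2) ^ 2 ≤ cE) (hB₃ : 0 ≤ B₃)
    (heRa : ∀ i, (cE + 1) * eR i ≤ a₁' ∧ B₃ * ((cE + 1) * eR i) ≤ ν.εreg)
    (hcA : 1 / 2 * (B₃ * (cE + 1) * (F.P Kt).eta 1 ^ 2) ^ 2 * (Fintype.card (Plaq (F.P Kt) 0) : ℝ) ≤ cA)
    -- [15] THEOREM 1 (R) AT `Z`'S SEQUENCE (instance-level letter replacing (Vn); see `nearValue_letter_of_thm1AtZSeq`)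
    (h15Z : ∀ i (δ : ℕ → ℝ), (∀ j, j ≤ k i → 0 < δ j ∧ δ j ≤ a₁' ∧ B₃ * δ j ≤ ν.εreg) → (∀ j, j < k i → δ j ≤ 2 * δ (j + 1)) →
      (∀ j, j < k i → δ (j + 1) ≤ 2 * δ j) →
      ∀ W : MSField (F.P Kt) SU2,
        Node00.Sect2.DataSmall7PTop (Node00.avOfRecord F 2 Kt) (maxDomT ν.M₁ (Z i)) (Node00.suppDomOfRecord F ν Kt (maxDomT ν.M₁ (Z i))) (k i) δ W →
        ∀ U₀ : GaugeField (F.P Kt) 0 SU2, IsMinimizer (Node00.avOfRecord F 2 Kt)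
            {U | (∀ j, j ≤ k i → PlaqSmallOn (Node00.Sect2.omegaPlaqsTop (maxDomT ν.M₁ (Z i)) (Node00.suppDomOfRecord F ν Kt (maxDomT ν.M₁ (Z i))) j)
                ((ν.εreg : ℝ) * (F.P Kt).eta j ^ 2) U) ∧
              Node00.Sect2.CoDivClassOnTop (maxDomT ν.M₁ (Z i)) (Node00.suppDomOfRecord F ν Kt (maxDomT ν.M₁ (Z i))) (k i) ν.εreg U}
            (genSet (maxDomT ν.M₁ (Z i)) (k i)) W U₀ →
          (∀ j, j ≤ k i → PlaqSmallOn (Node00.Sect2.omegaPlaqsTop (maxDomT ν.M₁ (Z i)) (Node00.suppDomOfRecord F ν Kt (maxDomT ν.M₁ (Z i))) j)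
              (B₃ * δ j * (F.P Kt).eta j ^ 2) U₀) ∧
            ∀ j, j ≤ k i → Node00.Sect2.CoDivSmallOn (Node00.Sect2.omegaBondsTop (maxDomT ν.M₁ (Z i)) (Node00.suppDomOfRecord F ν Kt (maxDomT ν.M₁ (Z i))) j)
              (B₃ * δ j * (F.P Kt).eta j ^ 3) U₀)
    (hcJ' : ∀ i, 2 * cA * eR i / R i + 4 * 𝓐 i / (R i * eR i) ≤ cJ)
    : ∃ a₁ : ι → ℝ, (∀ i, 0 < a₁ i) ∧
      B15.Prop1Printed (lfVarOn su2Chart fun i =>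
        InstOn.std (Node00.bgMSCoPOfRecord F 2 ν Kt (k i) (maxDomT ν.M₁ (Z i))) ν.M₁ (Z i) (Λ i) (k i) (M i) (a₁ i)
          (anExt (pts (k i) (Λ i)) (T i)
            (fun177std (Node00.bgMSCoPOfRecord F 2 ν Kt (k i) (maxDomT ν.M₁ (Z i))) ν.M₁ (Z i) (k i)) (ext i)
            (min (1 / 2) (min (R i / 8) (γ / (M i) ^ 5 * (R i / 2) ^ 2 / (48 * (4 * 𝓐 i / R i + 1))))))) :=
  exists_domain_prop1Printed_lfVarOn_std_su2_box_intrinsic_analytic_atZSeqCoPRecord_ofNearValue ν Kt hd3 h0 hcl Z Λ k M hk0 hk eR heR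
    T lo hi n hn hN hbox hZ hTG0 hN5 K hK1 hKn ext hext hlohi hγ hcJ hbx hbxM hM hR h𝓐 n' hn' hGj hlead hsm hγle hfar
    (nearValue_letter_of_thm1AtZSeq_geom ν Kt hd3 Z Λ k hk0 hk eR lo hi n hn hbox hZ hN5 ext hext hlohi hZblk hM2 hdiv hcE0 hcE hB₃
      heRa hcA h15Z) hcJ'

end EndpointGeom

end Literature.MathematicalPhysics.QuantumFieldTheory.Balaban1983to89.B15Prop1DatumSmall7AtZSequence

end
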